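import Literature.NumberTheory.LFunctions.RodgersTaoWeakEnergyBoundProofs
import Literature.NumberTheory.LFunctions.RodgersTaoRiemannVonMangoldtProofs
import Literature.NumberTheory.LFunctions.RodgersTaoWeakEnergyPigeonholeProofs
import Literature.NumberTheory.LFunctions.RodgersTaoWeakEnergyFarFieldProofs
import HarnessLib

/-!
# Rodgers–Tao 2020, Prop. 6.1 (weak bound on integrated energy) — RH-FREE CONTENT twin, Part IV:
# the refined environment estimate, the pigeonhole over enlargements, and the assembly

RH-FREE literature proofs (no definitions, no named facts, no `sorry`). Trunk T-ANT
(`Literature/NumberTheory/LFunctions`). This is the ASSEMBLY file of the C3 cell's programme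
«P6.1 CONTENT twin» (rt-lead rulings (46)(c), (49)(a), (52)(a), (57); rt/STATUS 2026-08-26), whose
parts are: Part I `RodgersTaoWeakEnergyBoundProofs.lean` (the integrated Lemma 12 (v), p441889),
Part II `RodgersTaoWeakEnergyPigeonholeProofs.lean` (the abstract pigeonhole over ratios, p441030),
Part III `RodgersTaoWeakEnergyLocationProofs.lean` (abstract location-law lemmas, p442465 — not
imported here), the far-field file `RodgersTaoWeakEnergyFarFieldProofs.lean` (per-zero far energy
sums are `O(1)`, p445715, built on `RodgersTaoGapBoundProofs.lean` §A, p442229), and this file.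

> B. Rodgers, T. Tao, *The de Bruijn–Newman constant is non-negative*, Forum Math. Pi 8 (2020)
> e6 (= arXiv:1801.05914v5), **Proposition 15** (= v4 Prop. 6.1, FMP p. 38): "Let `J > 0`. Then
> `∫_{Λ/2}^0 Σ_{J ≤ j < k ≤ 2J} E_{jk}(t) dt ≪ J² log₊^{O(1)} J`." Proof, pp. 38–39: "From (52) we
> have a crude lower bound `Q_{[J,2J]_{ℤ*}} ≫ J log^{−O(1)} J` while from Proposition 13 we have an
> extremely crude upper bound `Q_{[0.5J,3J]_{ℤ*}} ≪ exp(O(log² J log log J))`. … By the pigeonhole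
> principle, we can then therefore find an interval `K` … such that `Q_{K'} ≤ (1 + J^{−0.1}) Q_K`
> (61) … Next, we apply Lemma 12(v) and use the fundamental theorem of calculus … From
> Proposition 13, the left-hand side is `O(J² log^{O(1)} J)` … Using `ab ≪ a² + b²` … Using (52),
> the contribution to the integral of those `j` outside of `K'` may be crudely bounded by
> `O(J² log^{O(1)} J)` … The contribution of those `j` inside `K'` may be bounded by
> `Q_{K'} − Q_K ≤ J^{−0.1} Q_K`, thanks to (61). We conclude that `Q_K ≪ J² log^{O(1)} J` and the
> claim follows."

## Main results (all `theorem`s, 0 new facts; namespace `Literature.NumberTheory.LFunctions`)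

* `rodgers_tao_weak_energy_bound_of` — **the CONTENT twin** (house time-translated form, cell
  ruling R2 / (46)(c)): for `t₀ < t₁ < t₂` with `H_{t₀}` real-rooted and the location law (50) on
  `[t₁, t₂]` (hypothesis `H2`, the shape of `rodgers_tao_gap_bound_of` and of
  `RodgersTao2020.cor33_location_of_count_estimate`), there are `M₀ ≥ 0` and `α` (`= 3`) with
  `∫_{t₁}^{t₂} Σ_{J ≤ j < k ≤ 2J} E_{jk}(t) dt ≤ M₀ J² log₊^α J` for all real `J ≥ 1`
  (and the sum is empty for `J < 1`, `interactionEnergyDyadicSum_eq_zero_of_lt_one`). Proposition 13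
  is NOT a hypothesis: it is the kernel theorem `rodgers_tao_gap_bound_of` (p442229) under `H2`.
* `rodgers_tao_weak_energy_bound_of_cor33_location :
  RodgersTao2020.cor33_location → rodgers_tao_weak_energy_bound` — the as-printed reduction onto the
  typed (VACUOUS-AS-PRINTED) fact of `RodgersTaoGapsEnergy.lean` (interval-integrability and all
  `J > 0` included).
* `rodgers_tao_weak_energy_bound_of_far` — the same with the per-zero far-field constant of
  `exists_far_interactionEnergy_sum_le` kept as an explicit hypothesis (the assembly proper).
* The steps, in the order of the printed proof:
  §1–§2 `abs_sum_offDiag_rodgersTaoCrossTerm_le_near_far`, `abs_sum_offDiag_rodgersTaoCrossSum_le_near_far`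
  (the environment term split at index distance `L`:
  `|Σ_{k≠k'∈K} S_{kk'}| ≤ 4L·NEAR_L + 2|K|·FAR_L`), `tsum_near_le_half_sub`
  (`NEAR_L ≤ (Σ_{K'.offDiag} E − Σ_{K.offDiag} E)/2` for `K'` containing the `L`-neighbourhood of `K`);
  §3 `four_mul_integral_le_of_far_le` (the refined basic inequality
  `4Q_K ≤ ΣH(t₁) − ΣH(t₂) + 4L(Q_{K'} − Q_K) + 4|K|Φ(t₂−t₁)`);
  §4 the Hamiltonian terms and the "extremely crude upper bound" under the gap bound
  (`sum_offDiag_hamiltonianInteraction_le_of_gapBound`, `sum_offDiag_interactionEnergy_le_of_gapBound`,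
  `E_{jk} = e^{2H_{jk}}`) and the location law (`neg_sum_offDiag_hamiltonianInteraction_le_of_location`);
  §5 the crude lower bound from consecutive gaps (`classicalLocation_add_one_sub_lt_four_pi`,
  `deBruijnZero_succ_sub_le_of_location`, `sub_div_sq_le_sum_offDiag_interactionEnergy`);
  §6 `tsum_far_le_card_mul` (`FAR_L ≤ |K|·C` from the per-zero bound);
  §7 `three_mul_integral_le_of_step` (one enlargement with ratio `1 + 1/(4L)` gives
  `3Q_K ≤ ΣH(t₁) − ΣH(t₂) + 4|K|²C(t₂−t₁)`) and `three_mul_integral_le_of_chain` (the chain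
  `K_i = [a − iL, b + iL]_{ℤ*}` with Part II's `exists_succ_le_one_add_mul_of_lt_pow`);
  §8 `growth_of_large` (the ratio comparison "`(1+J^{−0.1})^{0.5J/J^{0.1}}` beats
  `exp(O(log² J log log J))`", here `(1 + 1/(4L))^m` with `L ≍ log² J`, `m ≍ J/L`, beyond an explicit
  polylog threshold obtained from `Real.isLittleO_pow_log_id_atTop`), `chain_rhs_le`, and the
  assembly (large `J` by the chain, bounded `J` by monotonicity `Q_{[J,2J]} ≤ Q_{[1,N₁]}`).

DIVERGENCES from the printed proof (statement-level: none beyond the house time translation).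
(1) E13 (cell errata list; rt-ref row 77): the printed "using `ab ≪ a² + b²`" applied termwise over
the ordered pairs `k ≠ k'` costs a factor `|K| − 1 ≍ J` (recorded honestly in Part I,
`abs_sum_offDiag_rodgersTaoCrossSum_le`), which the absorption `Q_{K'} − Q_K ≤ J^{−0.1}Q_K` cannot
pay. Repair used here: `|Σ_{k≠k'} a_k a_{k'}| ≤ (Σ_k |a_k|)² ≤ 2(Σ_near)² + 2(Σ_far)²` and
Cauchy–Schwarz on each part, with "near" = the `≤ 2L` indices of `K` within index distance `< L` of
`j` (absorbed by the pigeonhole, ratio `1 + 1/(4L)` so that `4L · (ratio − 1) = 1`) and "far" paid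
by the location law through the per-zero `O(1)` far-energy bound of `RodgersTaoWeakEnergyFarFieldProofs`
(from `RodgersTaoGapBoundProofs` §A: `interactionEnergy_far_right/left`, `sum_interactionEnergy_neg_le`),
total `O(|K|²) = O(J²)`. (2) Enlargement steps of length `L = ⌈D log₊² N⌉` (`N = ⌊3J⌋`) and ratio
`1 + 1/(4L)` replace the printed `J^{0.1}` and `1 + J^{−0.1}`; the number of steps is
`m = ⌊(J/2 − 2)/L⌋`, and `(1 + 1/(4L))^m ≥ e^{m/(8L)}` beats `N² G_N² e^{2A ℓ(N)}` (crude upper over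
crude lower bound) once `C_* log⁷(4J) < J`. (3) As in `RodgersTaoGapBoundProofs`, display (52) is
not used: (50) and Lemma 8 suffice. (4) The crude lower bound is used only through
`Q_{[J,2J]} ≥ (t₂ − t₁)/G_N²` (one consecutive pair would do); the printed `J log^{−O(1)} J` is not
needed for the ratio argument in this parametrisation.

bears_on: N-C/N-P (COLUMN 3 DBN). WHAT THIS IS NOT: the time-translated, RH-free form of an
integrated energy bound for the zeros of `H_t` above a real-rooted time; the printed `Λ/2 ≤ t ≤ 0`
instance is VACUOUS-AS-PRINTED (`rodgers_tao_weak_energy_bound`, EX-FALSO discharged in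
`RodgersTaoGapsEnergy.lean`); nothing here bears on the truth of RH.

## References

* B. Rodgers, T. Tao, Forum Math. Pi 8 (2020) e6, Prop. 15 pp. 38–39 (= arXiv:1801.05914v5
  Prop. 6.1; v5 TeX l.940–975), Lemma 12 p. 30, Prop. 13 p. 34, Cor. 10 (50) p. 23, Lemma 8 p. 21.
-/

noncomputable section

open Set Filter Topology MeasureTheory intervalIntegral Real

namespace Literature.NumberTheory.LFunctions

/-! ### §1 The refined near/far split of the environment sum (pointwise in `t` and `j`) -/

/-- For fixed `t`, `j` and finite `K`: `|Σ_{(k,k')∈K.offDiag} 1/((x_j−x_k)(x_j−x_{k'}))| ≤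
(Σ_{k∈K} |x_j − x_k|⁻¹)²` (drop the constraint `k ≠ k'` after taking absolute values).
[cite: RodgersTaoFMP2020, Prop. 15 proof p. 39] -/
theorem abs_sum_offDiag_rodgersTaoCrossTerm_le_sq (t : ℝ) (K : Finset ℤ) (j : ℤ) :
    |∑ p ∈ K.offDiag, rodgersTaoCrossTerm t p.1 p.2 j| ≤
      (∑ k ∈ K, |deBruijnZeroZ t j - deBruijnZeroZ t k|⁻¹) ^ 2 := by
  classical
  set a : ℤ → ℝ := fun k ↦ |deBruijnZeroZ t j - deBruijnZeroZ t k|⁻¹ with ha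
  have hterm : ∀ p : ℤ × ℤ, |rodgersTaoCrossTerm t p.1 p.2 j| = a p.1 * a p.2 := fun p ↦ by
    rw [rodgersTaoCrossTerm_eq, one_div, mul_inv, abs_mul, abs_inv, abs_inv]
  have ha0 : ∀ k, 0 ≤ a k := fun k ↦ inv_nonneg.2 (abs_nonneg _)
  calc |∑ p ∈ K.offDiag, rodgersTaoCrossTerm t p.1 p.2 j|
      ≤ ∑ p ∈ K.offDiag, |rodgersTaoCrossTerm t p.1 p.2 j| := Finset.abs_sum_le_sum_abs _ _
    _ = ∑ p ∈ K.offDiag, a p.1 * a p.2 := Finset.sum_congr rfl fun p _ ↦ hterm p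
    _ ≤ ∑ p ∈ K ×ˢ K, a p.1 * a p.2 := by
        apply Finset.sum_le_sum_of_subset_of_nonneg
        · rw [← Finset.diag_union_offDiag]; exact Finset.subset_union_right
        · exact fun p _ _ ↦ mul_nonneg (ha0 _) (ha0 _)
    _ = (∑ k ∈ K, a k) ^ 2 := by rw [sq, Finset.sum_mul_sum, Finset.sum_product]

/-- Cauchy–Schwarz on the two halves of a partition: `(Σ_{k∈K} u_k)² ≤ 2·#{k∈K | P k}·Σ_{P} u_k²
+ 2·#{k∈K | ¬P k}·Σ_{¬P} u_k²`. [cite: RodgersTaoFMP2020, Prop. 15 proof p. 39] -/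
theorem sq_sum_le_two_mul_card_filter_mul_sum_sq (K : Finset ℤ) (P : ℤ → Prop) [DecidablePred P]
    (u : ℤ → ℝ) :
    (∑ k ∈ K, u k) ^ 2 ≤
      2 * (((K.filter P).card : ℝ) * ∑ k ∈ K.filter P, u k ^ 2) +
        2 * (((K.filter fun k ↦ ¬P k).card : ℝ) * ∑ k ∈ K.filter (fun k ↦ ¬P k), u k ^ 2) := by
  rw [← Finset.sum_filter_add_sum_filter_not K P u]
  have h1 := sq_sum_le_card_mul_sum_sq (s := K.filter P) (f := u)
  have h2 := sq_sum_le_card_mul_sum_sq (s := K.filter fun k ↦ ¬P k) (f := u)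
  nlinarith [sq_nonneg (∑ k ∈ K.filter P, u k - ∑ k ∈ K.filter (fun k ↦ ¬P k), u k)]

/-- The indices of `K` at distance `< L` from `j` number at most `2L`.
[cite: RodgersTaoFMP2020, Prop. 15 proof p. 39] -/
theorem card_filter_abs_sub_lt_le (K : Finset ℤ) (j : ℤ) (L : ℕ) :
    ((K.filter fun k ↦ |k - j| < L).card : ℝ) ≤ 2 * L := by
  have hsub : (K.filter fun k ↦ |k - j| < L) ⊆ Finset.Ioo (j - L) (j + L) := by
    intro k hk
    rw [Finset.mem_filter] at hk
    rw [Finset.mem_Ioo]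
    constructor <;> linarith [(abs_lt.1 hk.2).1, (abs_lt.1 hk.2).2]
  have hcard := Finset.card_le_card hsub
  rw [Int.card_Ioo] at hcard
  have h2 : (j + L - (j - L) - 1).toNat ≤ 2 * L := Int.toNat_le.2 (by push_cast; omega)
  exact_mod_cast hcard.trans h2

/-- **E13 repair, pointwise form**: for any cut-off `L`,
`|Σ_{(k,k')∈K.offDiag} 1/((x_j−x_k)(x_j−x_{k'}))| ≤ 4L·Σ_{k∈K, |k−j|<L} E_{jk} + 2|K|·Σ_{k∈K, |k−j|≥L} E_{jk}`
(Cauchy–Schwarz separately over the `≤ 2L` indices near `j` and the `≤ |K|` far ones; replaces the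
termwise "`ab ≪ a² + b²`" of the printed proof, which loses a factor `|K|`).
[cite: RodgersTaoFMP2020, Prop. 15 proof p. 39] -/
theorem abs_sum_offDiag_rodgersTaoCrossTerm_le_near_far (t : ℝ) (K : Finset ℤ) (j : ℤ) (L : ℕ) :
    |∑ p ∈ K.offDiag, rodgersTaoCrossTerm t p.1 p.2 j| ≤
      4 * L * ∑ k ∈ K.filter (fun k ↦ |k - j| < L), interactionEnergy t j k +
        2 * K.card * ∑ k ∈ K.filter (fun k ↦ ¬|k - j| < L), interactionEnergy t j k := by
  classical
  set u : ℤ → ℝ := fun k ↦ |deBruijnZeroZ t j - deBruijnZeroZ t k|⁻¹ with hu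
  have hu2 : ∀ k, u k ^ 2 = interactionEnergy t j k := fun k ↦ by
    rw [hu, interactionEnergy_eq]; simp only
    rw [inv_pow, sq_abs, one_div]
  have h1 := abs_sum_offDiag_rodgersTaoCrossTerm_le_sq t K j
  have h2 := sq_sum_le_two_mul_card_filter_mul_sum_sq K (fun k ↦ |k - j| < L) u
  simp only [hu2] at h2
  have hN := card_filter_abs_sub_lt_le K j L
  have hF : ((K.filter fun k ↦ ¬|k - j| < L).card : ℝ) ≤ K.card := by
    exact_mod_cast Finset.card_filter_le _ _
  have hSN : 0 ≤ ∑ k ∈ K.filter (fun k ↦ |k - j| < L), interactionEnergy t j k :=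
    Finset.sum_nonneg fun _ _ ↦ interactionEnergy_nonneg _ _ _
  have hSF : 0 ≤ ∑ k ∈ K.filter (fun k ↦ ¬|k - j| < L), interactionEnergy t j k :=
    Finset.sum_nonneg fun _ _ ↦ interactionEnergy_nonneg _ _ _
  calc |∑ p ∈ K.offDiag, rodgersTaoCrossTerm t p.1 p.2 j|
      ≤ (∑ k ∈ K, u k) ^ 2 := h1
    _ ≤ _ := h2
    _ ≤ 2 * ((2 * L) * ∑ k ∈ K.filter (fun k ↦ |k - j| < L), interactionEnergy t j k) +
          2 * ((K.card : ℝ) * ∑ k ∈ K.filter (fun k ↦ ¬|k - j| < L), interactionEnergy t j k) := by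
        gcongr
    _ = _ := by ring

/-! ### §2 Summation over the environment `j ∈ ℤ* ∖ K` -/

/-- Summability over `ℤ* ∖ K` of the near part `j ↦ Σ_{k∈K, |k−j|<L} E_{jk}(t)` and of the far
part (both dominated by `Σ_{k∈K} E_{jk}`), `t > Λ`. [cite: RodgersTaoFMP2020, Prop. 15 proof p. 39] -/
theorem summable_sum_filter_interactionEnergy {t : ℝ}
    (hΛ : ∃ t₁ : ℝ, t₁ < t ∧ HasOnlyRealZeros (deBruijnH t₁)) (K : Finset ℤ) (P : ℤ → ℤ → Prop)
    [∀ j k, Decidable (P j k)] :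
    Summable fun j : zstarCompl K ↦ ∑ k ∈ K.filter (fun k ↦ P j k), interactionEnergy t j k := by
  have hmaj : Summable fun j : zstarCompl K ↦ ∑ k ∈ K, interactionEnergy t j k := by
    have h : Summable fun j : ℤ ↦ ∑ k ∈ K, interactionEnergy t j k :=
      summable_sum fun k _ ↦ summable_interactionEnergy_int hΛ k
    exact h.subtype _
  refine Summable.of_nonneg_of_le (fun j ↦ Finset.sum_nonneg fun _ _ ↦ interactionEnergy_nonneg _ _ _)
    (fun j ↦ ?_) hmaj
  exact Finset.sum_le_sum_of_subset_of_nonneg (Finset.filter_subset _ _)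
    fun _ _ _ ↦ interactionEnergy_nonneg _ _ _

/-- **E13 repair, summed over the environment** (`t > Λ`, finite `K ⊂ ℤ`, any cut-off `L`):
`|Σ_{k≠k'∈K} S_{kk'}(t)| ≤ 4L · NEAR_L(t) + 2|K| · FAR_L(t)` with
`NEAR_L(t) = Σ_{j∈ℤ*∖K} Σ_{k∈K, |k−j|<L} E_{jk}(t)` and `FAR_L(t) = Σ_{j∈ℤ*∖K} Σ_{k∈K, |k−j|≥L} E_{jk}(t)`.
[cite: RodgersTaoFMP2020, Prop. 15 proof p. 39] -/
theorem abs_sum_offDiag_rodgersTaoCrossSum_le_near_far {t : ℝ}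
    (hΛ : ∃ t₁ : ℝ, t₁ < t ∧ HasOnlyRealZeros (deBruijnH t₁)) (K : Finset ℤ) (L : ℕ) :
    |∑ p ∈ K.offDiag, rodgersTaoCrossSum t K p.1 p.2| ≤
      4 * L * ∑' j : zstarCompl K, ∑ k ∈ K.filter (fun k ↦ |k - (j : ℤ)| < L), interactionEnergy t j k +
        2 * K.card *
          ∑' j : zstarCompl K, ∑ k ∈ K.filter (fun k ↦ ¬|k - (j : ℤ)| < L), interactionEnergy t j k := by
  classical
  have hc : ∀ p ∈ K.offDiag, Summable fun j : zstarCompl K ↦ rodgersTaoCrossTerm t p.1 p.2 j :=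
    fun p _ ↦ (summable_rodgersTaoCrossTerm_int hΛ p.1 p.2).subtype _
  have hswap : ∑ p ∈ K.offDiag, rodgersTaoCrossSum t K p.1 p.2 =
      ∑' j : zstarCompl K, ∑ p ∈ K.offDiag, rodgersTaoCrossTerm t p.1 p.2 j := by
    simp only [rodgersTaoCrossSum]
    exact (Summable.tsum_finsetSum hc).symm
  have hN := summable_sum_filter_interactionEnergy hΛ K (fun j k ↦ |k - j| < (L : ℤ))
  have hF := summable_sum_filter_interactionEnergy hΛ K (fun j k ↦ ¬|k - j| < (L : ℤ))
  have hmaj : Summable fun j : zstarCompl K ↦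
      4 * L * ∑ k ∈ K.filter (fun k ↦ |k - (j : ℤ)| < L), interactionEnergy t j k +
        2 * K.card * ∑ k ∈ K.filter (fun k ↦ ¬|k - (j : ℤ)| < L), interactionEnergy t j k :=
    (hN.mul_left _).add (hF.mul_left _)
  have hle : ∀ j : zstarCompl K, ‖∑ p ∈ K.offDiag, rodgersTaoCrossTerm t p.1 p.2 j‖ ≤
      4 * L * ∑ k ∈ K.filter (fun k ↦ |k - (j : ℤ)| < L), interactionEnergy t j k +
        2 * K.card * ∑ k ∈ K.filter (fun k ↦ ¬|k - (j : ℤ)| < L), interactionEnergy t j k := fun j ↦ by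
    rw [Real.norm_eq_abs]; exact abs_sum_offDiag_rodgersTaoCrossTerm_le_near_far t K j L
  have hnorm : Summable fun j : zstarCompl K ↦ ‖∑ p ∈ K.offDiag, rodgersTaoCrossTerm t p.1 p.2 j‖ :=
    Summable.of_nonneg_of_le (fun _ ↦ norm_nonneg _) hle hmaj
  rw [hswap]
  calc |∑' j : zstarCompl K, ∑ p ∈ K.offDiag, rodgersTaoCrossTerm t p.1 p.2 j|
      = ‖∑' j : zstarCompl K, ∑ p ∈ K.offDiag, rodgersTaoCrossTerm t p.1 p.2 j‖ :=
        (Real.norm_eq_abs _).symm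
    _ ≤ ∑' j : zstarCompl K, ‖∑ p ∈ K.offDiag, rodgersTaoCrossTerm t p.1 p.2 j‖ :=
        norm_tsum_le_tsum_norm hnorm
    _ ≤ ∑' j : zstarCompl K, (4 * L * ∑ k ∈ K.filter (fun k ↦ |k - (j : ℤ)| < L), interactionEnergy t j k +
          2 * K.card * ∑ k ∈ K.filter (fun k ↦ ¬|k - (j : ℤ)| < L), interactionEnergy t j k) :=
        hnorm.tsum_le_tsum hle hmaj
    _ = _ := by
        rw [(hN.mul_left _).tsum_add (hF.mul_left _), tsum_mul_left, tsum_mul_left]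

/-! ### §2b The near part against an enlargement `K ⊆ K'` -/

/-- If `K'` contains every `j ∈ ℤ* ∖ K` lying within index distance `< L` of `K`, then
`NEAR_L(t) ≤ Σ_{j∈K'∖K} Σ_{k∈K} E_{jk}(t)`. [cite: RodgersTaoFMP2020, Prop. 15 proof p. 39
("The contribution of those `j` inside `K'` may be bounded by `Q_{K'} − Q_K`")] -/
theorem tsum_near_le_sum_sdiff (t : ℝ) {K K' : Finset ℤ} (L : ℕ)
    (henl : ∀ j : ℤ, j ≠ 0 → j ∉ K → ∀ k ∈ K, |k - j| < L → j ∈ K') :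
    ∑' j : zstarCompl K, ∑ k ∈ K.filter (fun k ↦ |k - (j : ℤ)| < L), interactionEnergy t j k ≤
      ∑ j ∈ K' \ K, ∑ k ∈ K, interactionEnergy t j k := by
  classical
  set g : ℤ → ℝ := fun j ↦ ∑ k ∈ K.filter (fun k ↦ |k - j| < L), interactionEnergy t j k with hg
  have hg0 : ∀ j, 0 ≤ g j := fun j ↦ Finset.sum_nonneg fun _ _ ↦ interactionEnergy_nonneg _ _ _
  have hgle : ∀ j, g j ≤ ∑ k ∈ K, interactionEnergy t j k := fun j ↦
    Finset.sum_le_sum_of_subset_of_nonneg (Finset.filter_subset _ _)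
      fun _ _ _ ↦ interactionEnergy_nonneg _ _ _
  have hsupp : ∀ j ∉ K' \ K, (zstarCompl K).indicator g j = 0 := by
    intro j hj
    rw [Finset.mem_sdiff, not_and_or, not_not] at hj
    by_cases hjC : j ∈ zstarCompl K
    · rw [Set.indicator_of_mem hjC]
      rw [mem_zstarCompl] at hjC
      rcases hj with hj | hj
      · -- no `k ∈ K` is within distance `< L` of `j`
        refine Finset.sum_eq_zero fun k hk ↦ ?_
        rw [Finset.mem_filter] at hk
        exact absurd (henl j hjC.1 hjC.2 k hk.1 hk.2) hj
      · exact absurd hj hjC.2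
    · rw [Set.indicator_of_notMem hjC]
  change ∑' j : zstarCompl K, g j ≤ _
  rw [tsum_subtype (zstarCompl K) g, tsum_eq_sum hsupp]
  refine Finset.sum_le_sum fun j _ ↦ ?_
  by_cases hjC : j ∈ zstarCompl K
  · rw [Set.indicator_of_mem hjC]; exact hgle j
  · rw [Set.indicator_of_notMem hjC]
    exact Finset.sum_nonneg fun _ _ ↦ interactionEnergy_nonneg _ _ _

/-- Monotonicity of the truncated energy under enlargement, with the boundary terms made explicit:
`Σ_{K.offDiag} E + 2 Σ_{j∈K'∖K} Σ_{k∈K} E_{jk} ≤ Σ_{K'.offDiag} E` for `K ⊆ K'` (`E ≥ 0`, symmetric).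
[cite: RodgersTaoFMP2020, Prop. 15 proof p. 39] -/
theorem sum_offDiag_add_two_mul_sum_sdiff_le (t : ℝ) {K K' : Finset ℤ} (hKK' : K ⊆ K') :
    ∑ p ∈ K.offDiag, interactionEnergy t p.1 p.2 +
        2 * ∑ j ∈ K' \ K, ∑ k ∈ K, interactionEnergy t j k ≤
      ∑ p ∈ K'.offDiag, interactionEnergy t p.1 p.2 := by
  classical
  set A := K.offDiag
  set B := (K' \ K) ×ˢ K
  set C := K ×ˢ (K' \ K)
  have hAB : Disjoint A B := by
    rw [Finset.disjoint_left]
    intro p hpA hpB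
    rw [Finset.mem_offDiag] at hpA
    rw [Finset.mem_product, Finset.mem_sdiff] at hpB
    exact hpB.1.2 hpA.1
  have hAC : Disjoint A C := by
    rw [Finset.disjoint_left]
    intro p hpA hpC
    rw [Finset.mem_offDiag] at hpA
    rw [Finset.mem_product, Finset.mem_sdiff] at hpC
    exact hpC.2.2 hpA.2.1
  have hBC : Disjoint B C := by
    rw [Finset.disjoint_left]
    intro p hpB hpC
    rw [Finset.mem_product, Finset.mem_sdiff] at hpB hpC
    exact hpB.1.2 hpC.1
  have hABC : Disjoint (A ∪ B) C := Finset.disjoint_union_left.2 ⟨hAC, hBC⟩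
  have hsub : A ∪ B ∪ C ⊆ K'.offDiag := by
    intro p hp
    rw [Finset.mem_union, Finset.mem_union] at hp
    rw [Finset.mem_offDiag]
    rcases hp with (hp | hp) | hp
    · rw [Finset.mem_offDiag] at hp
      exact ⟨hKK' hp.1, hKK' hp.2.1, hp.2.2⟩
    · rw [Finset.mem_product, Finset.mem_sdiff] at hp
      exact ⟨hp.1.1, hKK' hp.2, fun h ↦ hp.1.2 (h ▸ hp.2)⟩
    · rw [Finset.mem_product, Finset.mem_sdiff] at hp
      exact ⟨hKK' hp.1, hp.2.1, fun h ↦ hp.2.2 (h ▸ hp.1)⟩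
  have hBsum : ∑ p ∈ B, interactionEnergy t p.1 p.2 = ∑ j ∈ K' \ K, ∑ k ∈ K, interactionEnergy t j k :=
    Finset.sum_product _ _ _
  have hCsum : ∑ p ∈ C, interactionEnergy t p.1 p.2 = ∑ j ∈ K' \ K, ∑ k ∈ K, interactionEnergy t j k := by
    rw [Finset.sum_product, Finset.sum_comm]
    exact Finset.sum_congr rfl fun j _ ↦ Finset.sum_congr rfl fun k _ ↦ interactionEnergy_comm _ _ _
  calc ∑ p ∈ A, interactionEnergy t p.1 p.2 + 2 * ∑ j ∈ K' \ K, ∑ k ∈ K, interactionEnergy t j k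
      = ∑ p ∈ A ∪ B ∪ C, interactionEnergy t p.1 p.2 := by
        rw [Finset.sum_union hABC, Finset.sum_union hAB, hBsum, hCsum]; ring
    _ ≤ ∑ p ∈ K'.offDiag, interactionEnergy t p.1 p.2 :=
        Finset.sum_le_sum_of_subset_of_nonneg hsub fun _ _ _ ↦ interactionEnergy_nonneg _ _ _

/-- Hence `NEAR_L(t) ≤ (Σ_{K'.offDiag} E(t) − Σ_{K.offDiag} E(t))/2` for such an enlargement.
[cite: RodgersTaoFMP2020, Prop. 15 proof p. 39 (display (pig) and "`Q_{K'} − Q_K ≤ J^{−0.1} Q_K`")] -/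
theorem tsum_near_le_half_sub (t : ℝ) {K K' : Finset ℤ} (hKK' : K ⊆ K')
    (L : ℕ) (henl : ∀ j : ℤ, j ≠ 0 → j ∉ K → ∀ k ∈ K, |k - j| < L → j ∈ K') :
    ∑' j : zstarCompl K, ∑ k ∈ K.filter (fun k ↦ |k - (j : ℤ)| < L), interactionEnergy t j k ≤
      (∑ p ∈ K'.offDiag, interactionEnergy t p.1 p.2 - ∑ p ∈ K.offDiag, interactionEnergy t p.1 p.2) / 2 := by
  have h1 := tsum_near_le_sum_sdiff t L henl (K' := K')
  have h2 := sum_offDiag_add_two_mul_sum_sdiff_le t hKK'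
  linarith

/-! ### §3 The refined basic inequality for `Q_K`, integrated over `[t₁, t₂]` -/

/-- **Refined basic inequality** (E13 repair of the printed route, house time-translated form):
for `Λ ≤ t₀ < t₁ ≤ t₂`, finite `K ⊆ K' ⊂ ℤ*` with `K'` containing the `L`-neighbourhood of `K` in
`ℤ*`, and a uniform bound `FAR_L(t) ≤ Φ` on `[t₁, t₂]`,
`4 Q_K ≤ (Σ_{K.offDiag} H(t₁) − Σ_{K.offDiag} H(t₂)) + 4L (Q_{K'} − Q_K) + 4|K| Φ (t₂ − t₁)`,
where `Q_I = ∫_{t₁}^{t₂} Σ_{I.offDiag} E`. [cite: RodgersTaoFMP2020, Prop. 15 proof p. 39] -/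
theorem four_mul_integral_le_of_far_le {t₀ t₁ t₂ : ℝ} (hreal : HasOnlyRealZeros (deBruijnH t₀))
    (ht₀ : t₀ < t₁) (h₁₂ : t₁ ≤ t₂) {K K' : Finset ℤ} (hKK' : K ⊆ K') (hK'0 : (0 : ℤ) ∉ K')
    (L : ℕ) (henl : ∀ j : ℤ, j ≠ 0 → j ∉ K → ∀ k ∈ K, |k - j| < L → j ∈ K') {Φ : ℝ}
    (hΦ : ∀ t ∈ Icc t₁ t₂,
      ∑' j : zstarCompl K, ∑ k ∈ K.filter (fun k ↦ ¬|k - (j : ℤ)| < L), interactionEnergy t j k ≤ Φ) :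
    4 * ∫ t in t₁..t₂, ∑ p ∈ K.offDiag, interactionEnergy t p.1 p.2 ≤
      (∑ p ∈ K.offDiag, hamiltonianInteraction t₁ p.1 p.2 -
          ∑ p ∈ K.offDiag, hamiltonianInteraction t₂ p.1 p.2) +
        4 * L * ((∫ t in t₁..t₂, ∑ p ∈ K'.offDiag, interactionEnergy t p.1 p.2) -
          ∫ t in t₁..t₂, ∑ p ∈ K.offDiag, interactionEnergy t p.1 p.2) +
        4 * K.card * Φ * (t₂ - t₁) := by
  have hK0 : (0 : ℤ) ∉ K := fun h ↦ hK'0 (hKK' h)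
  have hΛs : ∀ t ∈ Icc t₁ t₂, ∃ t₁' : ℝ, t₁' < t ∧ HasOnlyRealZeros (deBruijnH t₁') :=
    fun t ht ↦ ⟨t₀, lt_of_lt_of_le ht₀ ht.1, hreal⟩
  have hid := sum_offDiag_hamiltonianInteraction_sub_eq_integral hreal ht₀ h₁₂ K hK0
  have hE : IntervalIntegrable (fun t ↦ ∑ p ∈ K.offDiag, interactionEnergy t p.1 p.2) volume t₁ t₂ :=
    ((continuousOn_sum_offDiag_interactionEnergy hreal ht₀ K).mono (by rw [uIcc_of_le h₁₂])).intervalIntegrable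
  have hE' : IntervalIntegrable (fun t ↦ ∑ p ∈ K'.offDiag, interactionEnergy t p.1 p.2) volume t₁ t₂ :=
    ((continuousOn_sum_offDiag_interactionEnergy hreal ht₀ K').mono (by rw [uIcc_of_le h₁₂])).intervalIntegrable
  have hS : IntervalIntegrable (fun t ↦ ∑ p ∈ K.offDiag, rodgersTaoCrossSum t K p.1 p.2) volume t₁ t₂ :=
    ((continuousOn_sum_offDiag_rodgersTaoCrossSum hreal ht₀ K hK0).mono
      (by rw [uIcc_of_le h₁₂])).intervalIntegrable
  rw [intervalIntegral.integral_add (hE.const_mul (-4)) (hS.const_mul 2),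
    intervalIntegral.integral_const_mul, intervalIntegral.integral_const_mul] at hid
  -- pointwise: `2 S(t) ≤ 4L (E_{K'}(t) − E_K(t)) + 4 |K| Φ`
  have hpt : ∀ t ∈ Icc t₁ t₂, 2 * ∑ p ∈ K.offDiag, rodgersTaoCrossSum t K p.1 p.2 ≤
      4 * L * (∑ p ∈ K'.offDiag, interactionEnergy t p.1 p.2 - ∑ p ∈ K.offDiag, interactionEnergy t p.1 p.2) +
        4 * K.card * Φ := by
    intro t ht
    have h1 := abs_sum_offDiag_rodgersTaoCrossSum_le_near_far (hΛs t ht) K L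
    have h2 := tsum_near_le_half_sub t hKK' L henl
    have h3 := hΦ t ht
    have h4 := le_abs_self (∑ p ∈ K.offDiag, rodgersTaoCrossSum t K p.1 p.2)
    have hL : (0 : ℝ) ≤ 4 * L := by positivity
    have hKc : (0 : ℝ) ≤ 2 * K.card := by positivity
    nlinarith [mul_le_mul_of_nonneg_left h2 hL, mul_le_mul_of_nonneg_left h3 hKc]
  have hrhs : IntervalIntegrable (fun t ↦
      4 * L * (∑ p ∈ K'.offDiag, interactionEnergy t p.1 p.2 - ∑ p ∈ K.offDiag, interactionEnergy t p.1 p.2) +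
        4 * K.card * Φ) volume t₁ t₂ :=
    ((hE'.sub hE).const_mul _).add intervalIntegrable_const
  have hmono := intervalIntegral.integral_mono_on h₁₂ (hS.const_mul 2) hrhs hpt
  rw [intervalIntegral.integral_const_mul, intervalIntegral.integral_add ((hE'.sub hE).const_mul _)
    intervalIntegrable_const, intervalIntegral.integral_const_mul, intervalIntegral.integral_sub hE' hE,
    intervalIntegral.integral_const, smul_eq_mul] at hmono
  rw [mul_comm (t₂ - t₁)] at hmono
  linarith

/-! ### §4 The two Hamiltonian terms under the gap bound (H1) and the location law (H2) -/

/-- Under a Prop. 13-type bound `H_{jk}(t) ≤ A (log₊² j) log₊log₊ j` at the time `t`: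
`H_{jk}(t) ≤ max(A,0) · (log₊² N) log₊log₊ N` for `j ∈ [1, N]_{ℤ*}`, `k ∈ ℤ* ∖ {j}`.
[cite: RodgersTaoFMP2020, Prop. 13 (59) p. 34; Prop. 15 proof p. 39] -/
theorem hamiltonianInteraction_le_of_gapBound {t A : ℝ} {N : ℕ}
    (H1 : ∀ j k : ℤ, j ≠ 0 → k ≠ 0 → k ≠ j →
      hamiltonianInteraction t j k ≤ A * (logPlus j ^ 2 * logPlus (logPlus j)))
    {j k : ℤ} (hj : j ∈ zstarIcc 1 N) (hk : k ≠ 0) (hkj : k ≠ j) :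
    hamiltonianInteraction t j k ≤ max A 0 * (logPlus N ^ 2 * logPlus (logPlus N)) := by
  have h1 := mem_zstarIcc.1 hj
  have hlog : logPlus (j : ℝ) ≤ logPlus N := logPlus_mono (by
    rw [abs_of_nonneg (by exact_mod_cast (by omega : (0:ℤ) ≤ j)), Nat.abs_cast]
    exact_mod_cast h1.2.2)
  have hll : logPlus (logPlus (j : ℝ)) ≤ logPlus (logPlus N) := logPlus_mono (by
    rw [abs_of_nonneg (logPlus_nonneg _), abs_of_nonneg (logPlus_nonneg _)]; exact hlog)
  have hprod : logPlus (j : ℝ) ^ 2 * logPlus (logPlus (j : ℝ)) ≤ logPlus N ^ 2 * logPlus (logPlus N) :=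
    mul_le_mul (pow_le_pow_left₀ (logPlus_nonneg _) hlog 2) hll (logPlus_nonneg _) (sq_nonneg _)
  calc hamiltonianInteraction t j k ≤ A * (logPlus (j : ℝ) ^ 2 * logPlus (logPlus (j : ℝ))) :=
        H1 j k h1.1 hk hkj
    _ ≤ max A 0 * (logPlus (j : ℝ) ^ 2 * logPlus (logPlus (j : ℝ))) :=
        mul_le_mul_of_nonneg_right (le_max_left _ _)
          (mul_nonneg (sq_nonneg _) (logPlus_nonneg _))
    _ ≤ max A 0 * (logPlus N ^ 2 * logPlus (logPlus N)) :=
        mul_le_mul_of_nonneg_left hprod (le_max_right _ _)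

/-- Hence, for `K ⊆ [1, N]_{ℤ*}`: `Σ_{K.offDiag} H(t) ≤ |K|(|K|−1) · max(A,0) · (log₊² N) log₊log₊ N`.
[cite: RodgersTaoFMP2020, Prop. 15 proof p. 39 ("From Proposition 13, the left-hand side is
`O(J² log^{O(1)} J)`")] -/
theorem sum_offDiag_hamiltonianInteraction_le_of_gapBound {t A : ℝ} {N : ℕ} {K : Finset ℤ}
    (hK : K ⊆ zstarIcc 1 N)
    (H1 : ∀ j k : ℤ, j ≠ 0 → k ≠ 0 → k ≠ j →
      hamiltonianInteraction t j k ≤ A * (logPlus j ^ 2 * logPlus (logPlus j))) :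
    ∑ p ∈ K.offDiag, hamiltonianInteraction t p.1 p.2 ≤
      K.card * ((K.card : ℝ) - 1) * (max A 0 * (logPlus N ^ 2 * logPlus (logPlus N))) := by
  refine sum_offDiag_hamiltonianInteraction_le K fun p hp ↦ ?_
  rw [Finset.mem_offDiag] at hp
  exact hamiltonianInteraction_le_of_gapBound H1 (hK hp.1) (mem_zstarIcc.1 (hK hp.2.1)).1
    (Ne.symm hp.2.2)

/-- Under the same bound at a time `t > Λ`: `E_{jk}(t) = e^{2H_{jk}(t)} ≤ exp(2 max(A,0) (log₊² N)
log₊log₊ N)` for distinct `j, k ∈ [1, N]_{ℤ*}` — the "extremely crude upper bound" of the printed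
proof, termwise. [cite: RodgersTaoFMP2020, Prop. 15 proof p. 38] -/
theorem interactionEnergy_le_exp_of_gapBound {t A : ℝ} {N : ℕ}
    (hΛ : ∃ t₁ : ℝ, t₁ < t ∧ HasOnlyRealZeros (deBruijnH t₁))
    (H1 : ∀ j k : ℤ, j ≠ 0 → k ≠ 0 → k ≠ j →
      hamiltonianInteraction t j k ≤ A * (logPlus j ^ 2 * logPlus (logPlus j)))
    {j k : ℤ} (hj : j ∈ zstarIcc 1 N) (hk : k ≠ 0) (hkj : k ≠ j) :
    interactionEnergy t j k ≤ Real.exp (2 * (max A 0 * (logPlus N ^ 2 * logPlus (logPlus N)))) := by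
  have hne : deBruijnZeroZ t j ≠ deBruijnZeroZ t k :=
    fun h ↦ hkj ((strictMono_deBruijnZeroZ hΛ).injective h).symm
  have hd : 0 < |deBruijnZeroZ t j - deBruijnZeroZ t k| := abs_pos.2 (sub_ne_zero.2 hne)
  have hE : interactionEnergy t j k = Real.exp (2 * hamiltonianInteraction t j k) := by
    rw [interactionEnergy_eq, hamiltonianInteraction_eq, show (2 : ℝ) = ((2 : ℕ) : ℝ) by norm_num,
      Real.exp_nat_mul, Real.exp_log (one_div_pos.2 hd), div_pow, one_pow, sq_abs]
  rw [hE]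
  exact Real.exp_le_exp.2 (by linarith [hamiltonianInteraction_le_of_gapBound H1 hj hk hkj])

/-- The crude upper bound summed: `Σ_{K.offDiag} E(t) ≤ |K|(|K|−1) exp(2 max(A,0) (log₊² N) log₊log₊ N)`
for `K ⊆ [1, N]_{ℤ*}`, `t > Λ`. [cite: RodgersTaoFMP2020, Prop. 15 proof p. 38] -/
theorem sum_offDiag_interactionEnergy_le_of_gapBound {t A : ℝ} {N : ℕ} {K : Finset ℤ}
    (hΛ : ∃ t₁ : ℝ, t₁ < t ∧ HasOnlyRealZeros (deBruijnH t₁)) (hK : K ⊆ zstarIcc 1 N)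
    (H1 : ∀ j k : ℤ, j ≠ 0 → k ≠ 0 → k ≠ j →
      hamiltonianInteraction t j k ≤ A * (logPlus j ^ 2 * logPlus (logPlus j))) :
    ∑ p ∈ K.offDiag, interactionEnergy t p.1 p.2 ≤
      K.card * ((K.card : ℝ) - 1) * Real.exp (2 * (max A 0 * (logPlus N ^ 2 * logPlus (logPlus N)))) := by
  rw [← card_offDiag_cast]
  have h : ∀ p ∈ K.offDiag, interactionEnergy t p.1 p.2 ≤
      Real.exp (2 * (max A 0 * (logPlus N ^ 2 * logPlus (logPlus N)))) := fun p hp ↦ by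
    rw [Finset.mem_offDiag] at hp
    exact interactionEnergy_le_exp_of_gapBound hΛ H1 (hK hp.1) (mem_zstarIcc.1 (hK hp.2.1)).1
      (Ne.symm hp.2.2)
  calc ∑ p ∈ K.offDiag, interactionEnergy t p.1 p.2
      ≤ ∑ p ∈ K.offDiag, Real.exp (2 * (max A 0 * (logPlus N ^ 2 * logPlus (logPlus N)))) :=
        Finset.sum_le_sum h
    _ = _ := by rw [Finset.sum_const, nsmul_eq_mul]

/-- Under the location law `|x_j(t) − ξ_j| ≤ B log₊ ξ_j` (`1 ≤ j ≤ N`) at the time `t`: every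
`x_k(t)`, `k ∈ [1, N]_{ℤ*}`, lies in `[−D/2, D/2]` with `D = 2(ξ_N + B log₊ ξ_N)`.
[cite: RodgersTaoFMP2020, Cor. 10 (50) p. 23; Prop. 15 proof p. 39] -/
theorem abs_deBruijnZeroZ_le_of_location {t B : ℝ} {N : ℕ}
    (H2 : ∀ j : ℕ, 1 ≤ j → j ≤ N →
      |deBruijnZero t j - classicalLocation (j : ℝ)| ≤ B * logPlus (classicalLocation (j : ℝ)))
    {k : ℤ} (hk : k ∈ zstarIcc 1 N) :
    |deBruijnZeroZ t k| ≤ classicalLocation N + B * logPlus (classicalLocation N) := by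
  obtain ⟨hk0, hk1, hkN⟩ := mem_zstarIcc.1 hk
  -- `k = n` with `1 ≤ n ≤ N`
  obtain ⟨n, rfl⟩ := Int.eq_ofNat_of_zero_le (by omega : (0 : ℤ) ≤ k)
  have hn1 : 1 ≤ n := by exact_mod_cast hk1
  have hnN : n ≤ N := by exact_mod_cast hkN
  have hB : 0 ≤ B := by
    have h := H2 n hn1 hnN
    have hl := logPlus_pos (classicalLocation (n : ℝ))
    by_contra hB
    have : B * logPlus (classicalLocation (n : ℝ)) < 0 := mul_neg_of_neg_of_pos (lt_of_not_ge hB) hl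
    linarith [abs_nonneg (deBruijnZero t n - classicalLocation (n : ℝ))]
  have hn1' : (1 : ℝ) ≤ n := by exact_mod_cast hn1
  have hξmono : classicalLocation (n : ℝ) ≤ classicalLocation N :=
    strictMonoOn_classicalLocation.monotoneOn (by simp only [mem_Ici]; linarith)
      (by simp only [mem_Ici]; linarith [(Nat.cast_le (α := ℝ)).2 hnN]) (by exact_mod_cast hnN)
  have hξpos : 0 < classicalLocation (n : ℝ) := classicalLocation_pos (by linarith)
  have hlmono : logPlus (classicalLocation (n : ℝ)) ≤ logPlus (classicalLocation N) :=
    logPlus_mono (by rw [abs_of_pos hξpos, abs_of_pos (hξpos.trans_le hξmono)]; exact hξmono)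
  rw [deBruijnZeroZ_natCast]
  have h := abs_le.1 (H2 n hn1 hnN)
  have hx0 : 0 ≤ deBruijnZero t n := by
    have := deBruijnZero_nonneg t n
    exact this
  rw [abs_of_nonneg hx0]
  nlinarith [mul_le_mul_of_nonneg_left hlmono hB]

/-- Under the location law at `t` (`B ≥ 0`), for `K ⊆ [1, N]_{ℤ*}`:
`−Σ_{K.offDiag} H(t) ≤ |K|(|K|−1) log D`, `D = 2(ξ_N + B log₊ ξ_N)` (all gaps inside `K` are `≤ D`).
[cite: RodgersTaoFMP2020, Prop. 15 proof p. 39] -/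
theorem neg_sum_offDiag_hamiltonianInteraction_le_of_location {t B : ℝ} {N : ℕ} {K : Finset ℤ}
    (hB : 0 ≤ B) (hK : K ⊆ zstarIcc 1 N)
    (H2 : ∀ j : ℕ, 1 ≤ j → j ≤ N →
      |deBruijnZero t j - classicalLocation (j : ℝ)| ≤ B * logPlus (classicalLocation (j : ℝ))) :
    -∑ p ∈ K.offDiag, hamiltonianInteraction t p.1 p.2 ≤
      K.card * ((K.card : ℝ) - 1) *
        Real.log (2 * (classicalLocation N + B * logPlus (classicalLocation N))) := by
  have hξ : 4 * π ≤ classicalLocation (N : ℝ) :=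
    four_pi_le_classicalLocation (by linarith [(Nat.cast_nonneg N : (0 : ℝ) ≤ N)])
  have hD : 1 ≤ 2 * (classicalLocation N + B * logPlus (classicalLocation N)) := by
    nlinarith [Real.pi_gt_three, mul_nonneg hB (logPlus_nonneg (classicalLocation (N : ℝ)))]
  refine neg_sum_offDiag_hamiltonianInteraction_le K hD fun p hp ↦ ?_
  rw [Finset.mem_offDiag] at hp
  have h1 := abs_deBruijnZeroZ_le_of_location H2 (hK hp.1)
  have h2 := abs_deBruijnZeroZ_le_of_location H2 (hK hp.2.1)
  calc |deBruijnZeroZ t p.1 - deBruijnZeroZ t p.2| ≤ |deBruijnZeroZ t p.1| + |deBruijnZeroZ t p.2| :=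
        abs_sub _ _
    _ ≤ _ := by linarith

/-! ### §5 The crude lower bound: consecutive gaps under the location law -/

/-- Classical consecutive spacing: `ξ_{y+1} − ξ_y < 4π` for real `y ≥ 1` (mean value theorem for
`Ψ`, `Ψ' = log(·/4π)/(4π) > 1/(4π)` beyond `4πe < ξ_y`). [cite: RodgersTaoFMP2020, Lemma 8 (iii) p. 21] -/
theorem classicalLocation_add_one_sub_lt_four_pi {y : ℝ} (hy : 1 ≤ y) :
    classicalLocation (y + 1) - classicalLocation y < 4 * π := by
  obtain ⟨θ, hθ1, -, hθ⟩ := exists_classicalLocation_gap_mul_eq_one (by linarith : (-1 : ℝ) ≤ y)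
  have hπ : 0 < 4 * π := by positivity
  have he : 4 * π * Real.exp 1 < θ :=
    (RodgersTao2020.four_pi_mul_exp_one_lt_classicalLocation hy).trans hθ1
  have hlog : 1 < Real.log (θ / (4 * π)) := by
    have h' : Real.exp 1 < θ / (4 * π) := by rw [lt_div_iff₀ hπ]; linarith
    calc (1 : ℝ) = Real.log (Real.exp 1) := (Real.log_exp 1).symm
      _ < Real.log (θ / (4 * π)) := Real.log_lt_log (Real.exp_pos 1) h'
  have hgap : 0 < classicalLocation (y + 1) - classicalLocation y := by
    have := strictMonoOn_classicalLocation (show (-1 : ℝ) ≤ y by linarith)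
      (show (-1 : ℝ) ≤ y + 1 by linarith) (by linarith)
    linarith
  -- `gap · log(θ/4π) = 4π` and `log(θ/4π) > 1`
  have hprod : (classicalLocation (y + 1) - classicalLocation y) * Real.log (θ / (4 * π)) = 4 * π := by
    field_simp at hθ
    linarith
  nlinarith

/-- Consecutive gaps under the location law at `t` (`B ≥ 0`, `1 ≤ n < N`):
`x_{n+1}(t) − x_n(t) ≤ 4π + 2B log₊ ξ_N`. [cite: RodgersTaoFMP2020, Cor. 10 (50)–(51) p. 23;
Prop. 15 proof p. 38 ("From (51) we have a crude lower bound `Q_{[J,2J]} ≫ J log^{−O(1)} J`")] -/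
theorem deBruijnZero_succ_sub_le_of_location {t B : ℝ} {N : ℕ} (hB : 0 ≤ B)
    (H2 : ∀ j : ℕ, 1 ≤ j → j ≤ N →
      |deBruijnZero t j - classicalLocation (j : ℝ)| ≤ B * logPlus (classicalLocation (j : ℝ)))
    {n : ℕ} (hn1 : 1 ≤ n) (hnN : n + 1 ≤ N) :
    deBruijnZero t (n + 1) - deBruijnZero t n ≤ 4 * π + 2 * B * logPlus (classicalLocation N) := by
  have hn1' : (1 : ℝ) ≤ n := by exact_mod_cast hn1
  have hgap := classicalLocation_add_one_sub_lt_four_pi hn1'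
  have h1 := abs_le.1 (H2 n hn1 (by omega))
  have h2 := abs_le.1 (H2 (n + 1) (by omega) hnN)
  push_cast at h2
  -- monotonicity of `log₊ ξ`
  have hmono : ∀ m : ℕ, 1 ≤ m → m ≤ N → logPlus (classicalLocation (m : ℝ)) ≤ logPlus (classicalLocation N) := by
    intro m hm1 hmN
    have hm1' : (1 : ℝ) ≤ m := by exact_mod_cast hm1
    have hξmono : classicalLocation (m : ℝ) ≤ classicalLocation N :=
      strictMonoOn_classicalLocation.monotoneOn (by simp only [mem_Ici]; linarith)
        (by simp only [mem_Ici]; linarith [(Nat.cast_le (α := ℝ)).2 hmN]) (by exact_mod_cast hmN)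
    have hξpos : 0 < classicalLocation (m : ℝ) := classicalLocation_pos (by linarith)
    exact logPlus_mono (by rw [abs_of_pos hξpos, abs_of_pos (hξpos.trans_le hξmono)]; exact hξmono)
  have hm1 := mul_le_mul_of_nonneg_left (hmono n hn1 (by omega)) hB
  have hm2 := mul_le_mul_of_nonneg_left (hmono (n + 1) (by omega) hnN) hB
  push_cast at hm2
  linarith

/-- **Crude lower bound, pointwise**: under the location law at a time `t > Λ` (`B ≥ 0`), for
`1 ≤ a ≤ b ≤ N` and `K ⊇ [a, b]_{ℤ*}`:
`(b − a)/(4π + 2B log₊ ξ_N)² ≤ Σ_{K.offDiag} E(t)` (the `b − a` consecutive pairs each contribute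
at least `G⁻²`). [cite: RodgersTaoFMP2020, Prop. 15 proof p. 38] -/
theorem sub_div_sq_le_sum_offDiag_interactionEnergy {t B : ℝ} {N a b : ℕ} {K : Finset ℤ}
    (hΛ : ∃ t₁ : ℝ, t₁ < t ∧ HasOnlyRealZeros (deBruijnH t₁)) (hB : 0 ≤ B)
    (H2 : ∀ j : ℕ, 1 ≤ j → j ≤ N →
      |deBruijnZero t j - classicalLocation (j : ℝ)| ≤ B * logPlus (classicalLocation (j : ℝ)))
    (ha : 1 ≤ a) (hab : a ≤ b) (hbN : b ≤ N) (hK : zstarIcc a b ⊆ K) :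
    ((b : ℝ) - a) / (4 * π + 2 * B * logPlus (classicalLocation N)) ^ 2 ≤
      ∑ p ∈ K.offDiag, interactionEnergy t p.1 p.2 := by
  classical
  set G : ℝ := 4 * π + 2 * B * logPlus (classicalLocation N) with hG
  have hG0 : 0 < G := by
    have := mul_nonneg (mul_nonneg zero_le_two hB) (logPlus_nonneg (classicalLocation (N : ℝ)))
    rw [hG]; positivity
  -- the consecutive pairs `(n, n+1)`, `a ≤ n < b`, injected into `K.offDiag`
  set S : Finset ℕ := Finset.Ico a b with hS
  set e : ℕ → ℤ × ℤ := fun n ↦ ((n : ℤ), (n : ℤ) + 1) with he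
  have hinj : Set.InjOn e S := fun n _ m _ h ↦ by
    simp only [he, Prod.mk.injEq] at h; exact_mod_cast h.1
  have himg : S.image e ⊆ K.offDiag := by
    intro p hp
    rw [Finset.mem_image] at hp
    obtain ⟨n, hn, rfl⟩ := hp
    rw [hS, Finset.mem_Ico] at hn
    rw [Finset.mem_offDiag]
    simp only [he]
    refine ⟨hK (mem_zstarIcc.2 ⟨by omega, by omega, by omega⟩),
      hK (mem_zstarIcc.2 ⟨by omega, by omega, by omega⟩), by omega⟩
  have hcard : (S.card : ℝ) = b - a := by
    rw [hS, Nat.card_Ico, Nat.cast_sub hab]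
  have hterm : ∀ n ∈ S, (G ^ 2)⁻¹ ≤ interactionEnergy t (e n).1 (e n).2 := by
    intro n hn
    rw [hS, Finset.mem_Ico] at hn
    have hd := deBruijnZero_succ_sub_le_of_location hB H2 (n := n) (by omega) (by omega)
    have hpos : 0 < deBruijnZero t (n + 1) - deBruijnZero t n := by
      have h := strictMono_deBruijnZeroZ hΛ (show (n : ℤ) < (n : ℤ) + 1 by omega)
      rw [show ((n : ℤ) + 1) = ((n + 1 : ℕ) : ℤ) by push_cast; ring, deBruijnZeroZ_natCast,
        deBruijnZeroZ_natCast] at h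
      linarith
    rw [interactionEnergy_eq]
    simp only [he]
    rw [show ((n : ℤ) + 1) = ((n + 1 : ℕ) : ℤ) by push_cast; ring, deBruijnZeroZ_natCast,
      deBruijnZeroZ_natCast, one_div, ← neg_sub, neg_sq]
    exact inv_anti₀ (by positivity) (pow_le_pow_left₀ hpos.le (by rw [hG]; linarith) 2)
  calc ((b : ℝ) - a) / G ^ 2 = ∑ n ∈ S, (G ^ 2)⁻¹ := by
        rw [Finset.sum_const, nsmul_eq_mul, hcard, div_eq_mul_inv]
    _ ≤ ∑ n ∈ S, interactionEnergy t (e n).1 (e n).2 := Finset.sum_le_sum hterm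
    _ = ∑ p ∈ S.image e, interactionEnergy t p.1 p.2 :=
        (Finset.sum_image (f := fun p : ℤ × ℤ ↦ interactionEnergy t p.1 p.2) hinj).symm
    _ ≤ ∑ p ∈ K.offDiag, interactionEnergy t p.1 p.2 :=
        Finset.sum_le_sum_of_subset_of_nonneg himg fun _ _ _ ↦ interactionEnergy_nonneg _ _ _

/-! ### §6 The far part from a per-zero bound on finite far sums -/

/-- If every zero `x_k`, `k ∈ K`, has all its finite far-environment energy sums
`Σ_{j∈S} E_{jk}(t)` (`S ⊂ ℤ*`, `|k − j| ≥ L` on `S`) bounded by `C`, then `FAR_L(t) ≤ |K|·C`.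
[cite: RodgersTaoFMP2020, Prop. 15 proof p. 39 ("the contribution … of those `j` outside of `K'`
may be crudely bounded by `O(J² log^{O(1)} J)`")] -/
theorem tsum_far_le_card_mul {t : ℝ}
    (hΛ : ∃ t₁ : ℝ, t₁ < t ∧ HasOnlyRealZeros (deBruijnH t₁)) (K : Finset ℤ) (L : ℕ) {C : ℝ}
    (hfar : ∀ k ∈ K, ∀ S : Finset ℤ, (∀ j ∈ S, j ≠ 0 ∧ (L : ℤ) ≤ |k - j|) →
      ∑ j ∈ S, interactionEnergy t j k ≤ C) :
    ∑' j : zstarCompl K, ∑ k ∈ K.filter (fun k ↦ ¬|k - (j : ℤ)| < L), interactionEnergy t j k ≤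
      K.card * C := by
  classical
  -- rewrite the filtered inner sum as a sum of indicator terms and swap `Σ'_j` with `Σ_k`
  set f : ℤ → zstarCompl K → ℝ := fun k j ↦
    if ¬|k - (j : ℤ)| < L then interactionEnergy t j k else 0 with hf
  have hf0 : ∀ k j, 0 ≤ f k j := fun k j ↦ by
    simp only [hf]
    split_ifs <;> first | exact le_rfl | exact interactionEnergy_nonneg _ _ _
  have hfle : ∀ k j, f k j ≤ interactionEnergy t j k := fun k j ↦ by
    simp only [hf]
    split_ifs <;> first | exact le_rfl | exact interactionEnergy_nonneg _ _ _
  have hfs : ∀ k ∈ K, Summable (f k) := fun k _ ↦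
    Summable.of_nonneg_of_le (hf0 k) (hfle k) ((summable_interactionEnergy_int hΛ k).subtype _)
  have hrw : ∀ j : zstarCompl K,
      ∑ k ∈ K.filter (fun k ↦ ¬|k - (j : ℤ)| < L), interactionEnergy t j k = ∑ k ∈ K, f k j :=
    fun j ↦ by rw [hf, Finset.sum_filter]
  simp_rw [hrw]
  rw [Summable.tsum_finsetSum hfs]
  have hk : ∀ k ∈ K, ∑' j : zstarCompl K, f k j ≤ C := by
    intro k hkK
    refine Real.tsum_le_of_sum_le (hf0 k) fun u ↦ ?_
    -- the finite set of far indices met in `u`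
    set S : Finset ℤ := (u.map (Function.Embedding.subtype _)).filter (fun j ↦ ¬|k - j| < L) with hS
    have hSfar : ∀ j ∈ S, j ≠ 0 ∧ (L : ℤ) ≤ |k - j| := by
      intro j hj
      rw [hS, Finset.mem_filter, Finset.mem_map] at hj
      obtain ⟨⟨x, -, rfl⟩, hfarj⟩ := hj
      exact ⟨(mem_zstarCompl.1 x.2).1, not_lt.1 hfarj⟩
    have hsum : ∑ j ∈ u, f k j = ∑ j ∈ S, interactionEnergy t j k := by
      rw [hS, Finset.sum_filter, Finset.sum_map]
      rfl
    rw [hsum]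
    exact hfar k hkK S hSfar
  calc ∑ k ∈ K, ∑' j : zstarCompl K, f k j ≤ ∑ k ∈ K, C := Finset.sum_le_sum hk
    _ = K.card * C := by rw [Finset.sum_const, nsmul_eq_mul]

/-! ### §7 One enlargement step with the pigeonhole ratio: `3 Q_K ≤ Hamiltonian terms + far part` -/

/-- The `L`-neighbourhood in `ℤ*` of the discrete interval `[a, b]_{ℤ*}` lies in `[a − L, b + L]_{ℤ*}`.
[cite: RodgersTaoFMP2020, Prop. 15 proof p. 39 ("`K'` … is a slight enlargement of `K`")] -/
theorem mem_zstarIcc_enlarge {a b j : ℤ} {L : ℕ} (hj : j ≠ 0) {k : ℤ} (hk : k ∈ zstarIcc a b)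
    (hkj : |k - j| < L) : j ∈ zstarIcc (a - L) (b + L) := by
  obtain ⟨-, hka, hkb⟩ := mem_zstarIcc.1 hk
  have h := abs_lt.1 hkj
  exact mem_zstarIcc.2 ⟨hj, by omega, by omega⟩

/-- **One step** (house form of "`Q_K ≪ J² log^{O(1)} J + …` … `Q_{K'} − Q_K ≤ J^{−0.1} Q_K` …
We conclude that `Q_K ≪ J² log^{O(1)} J`", with the E13 repair): if `K = [a,b]_{ℤ*}`,
`K' = [a−L, b+L]_{ℤ*}`, `Q_{K'} ≤ (1 + 1/(4L)) Q_K`, and the far sums of every `x_k`, `k ∈ K`, are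
`≤ C` on `[t₁, t₂]`, then `3 Q_K ≤ Σ_{K.offDiag} H(t₁) − Σ_{K.offDiag} H(t₂) + 4|K|² C (t₂ − t₁)`.
[cite: RodgersTaoFMP2020, Prop. 15 proof p. 39] -/
theorem three_mul_integral_le_of_step {t₀ t₁ t₂ : ℝ} (hreal : HasOnlyRealZeros (deBruijnH t₀))
    (ht₀ : t₀ < t₁) (h₁₂ : t₁ ≤ t₂) {a b : ℤ} {L : ℕ} (hL : 1 ≤ L) {C : ℝ}
    (hfar : ∀ t ∈ Icc t₁ t₂, ∀ k ∈ zstarIcc a b, ∀ S : Finset ℤ,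
      (∀ j ∈ S, j ≠ 0 ∧ (L : ℤ) ≤ |k - j|) → ∑ j ∈ S, interactionEnergy t j k ≤ C)
    (hpig : ∫ t in t₁..t₂, ∑ p ∈ (zstarIcc (a - L) (b + L)).offDiag, interactionEnergy t p.1 p.2 ≤
      (1 + 1 / (4 * L)) * ∫ t in t₁..t₂, ∑ p ∈ (zstarIcc a b).offDiag, interactionEnergy t p.1 p.2) :
    3 * ∫ t in t₁..t₂, ∑ p ∈ (zstarIcc a b).offDiag, interactionEnergy t p.1 p.2 ≤
      (∑ p ∈ (zstarIcc a b).offDiag, hamiltonianInteraction t₁ p.1 p.2 -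
          ∑ p ∈ (zstarIcc a b).offDiag, hamiltonianInteraction t₂ p.1 p.2) +
        4 * (zstarIcc a b).card ^ 2 * C * (t₂ - t₁) := by
  set K := zstarIcc a b with hK
  set K' := zstarIcc (a - L) (b + L) with hK'
  have hKK' : K ⊆ K' := fun j hj ↦ by
    obtain ⟨hj0, hja, hjb⟩ := mem_zstarIcc.1 hj
    exact mem_zstarIcc.2 ⟨hj0, by omega, by omega⟩
  have hK'0 : (0 : ℤ) ∉ K' := zero_notMem_zstarIcc _ _
  have henl : ∀ j : ℤ, j ≠ 0 → j ∉ K → ∀ k ∈ K, |k - j| < L → j ∈ K' :=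
    fun j hj _ k hk hkj ↦ mem_zstarIcc_enlarge hj hk hkj
  have hΦ : ∀ t ∈ Icc t₁ t₂,
      ∑' j : zstarCompl K, ∑ k ∈ K.filter (fun k ↦ ¬|k - (j : ℤ)| < L), interactionEnergy t j k ≤
        K.card * C :=
    fun t ht ↦ tsum_far_le_card_mul ⟨t₀, lt_of_lt_of_le ht₀ ht.1, hreal⟩ K L (hfar t ht)
  have hmain := four_mul_integral_le_of_far_le hreal ht₀ h₁₂ hKK' hK'0 L henl hΦ
  set Q := ∫ t in t₁..t₂, ∑ p ∈ K.offDiag, interactionEnergy t p.1 p.2 with hQ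
  set Q' := ∫ t in t₁..t₂, ∑ p ∈ K'.offDiag, interactionEnergy t p.1 p.2 with hQ'
  have hL0 : (0 : ℝ) < L := by exact_mod_cast hL
  -- `4L (Q' − Q) ≤ Q`
  have hstep : 4 * (L : ℝ) * (Q' - Q) ≤ Q := by
    have h1 : Q' - Q ≤ 1 / (4 * L) * Q := by nlinarith
    have h2 := mul_le_mul_of_nonneg_left h1 (by positivity : (0 : ℝ) ≤ 4 * L)
    rwa [← mul_assoc, show 4 * (L : ℝ) * (1 / (4 * L)) = 1 by field_simp, one_mul] at h2
  have hcard : 4 * (K.card : ℝ) * (K.card * C) * (t₂ - t₁) = 4 * K.card ^ 2 * C * (t₂ - t₁) := by ring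
  linarith

/-- `[a', b']_{ℤ*} ⊆ [1, N]_{ℤ*}` and `|[a', b']_{ℤ*}| ≤ N` when `1 ≤ a'` and `b' ≤ N`.
[cite: RodgersTaoFMP2020, §1.2 p. 7] -/
theorem zstarIcc_subset_of_le {a' b' : ℤ} {N : ℕ} (ha : 1 ≤ a') (hb : b' ≤ N) :
    zstarIcc a' b' ⊆ zstarIcc 1 N ∧ ((zstarIcc a' b').card : ℝ) ≤ N := by
  have hsub : zstarIcc a' b' ⊆ zstarIcc 1 N := fun j hj ↦ by
    obtain ⟨hj0, hja, hjb⟩ := mem_zstarIcc.1 hj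
    exact mem_zstarIcc.2 ⟨hj0, by omega, by omega⟩
  refine ⟨hsub, ?_⟩
  have h1 : zstarIcc (1 : ℤ) N ⊆ Finset.Icc (1 : ℤ) N := Finset.filter_subset _ _
  have h2 := Finset.card_le_card (hsub.trans h1)
  rw [Int.card_Icc] at h2
  have h3 : ((N : ℤ) + 1 - 1).toNat = N := by simp
  rw [h3] at h2
  exact_mod_cast h2

/-- Arithmetic helper: `x ≤ N`, `x ≥ 0` ⇒ `x(x−1) ≤ N²` and `x² ≤ N²`. [folklore] -/
private theorem mul_sub_one_le_sq_aux {x N : ℝ} (hx : 0 ≤ x) (hxN : x ≤ N) :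
    x * (x - 1) ≤ N ^ 2 ∧ x ^ 2 ≤ N ^ 2 := by
  constructor <;> nlinarith

/-- **The chain of enlargements and the conclusion for one block** (house form of the whole
printed argument on p. 38–39 for a block `[a, b]_{ℤ*}` whose `m` enlargements by `L` stay inside
`[2, N]`): crude lower bound (consecutive gaps), extremely crude upper bound (`E = e^{2H}` and the
gap bound), pigeonhole over the ratios `Q_{K_{i+1}}/Q_{K_i}`, one step with the E13-repaired
environment estimate, and the two Hamiltonian bounds:
`3 Q_{[a,b]} ≤ N² (max(A,0)·log₊²N·log₊log₊N + log(2(ξ_N + B log₊ ξ_N))) + 4N² C (t₂ − t₁)`.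
[cite: RodgersTaoFMP2020, Prop. 15 proof pp. 38–39] -/
theorem three_mul_integral_le_of_chain {t₀ t₁ t₂ B A C : ℝ} (hreal : HasOnlyRealZeros (deBruijnH t₀))
    (ht₀ : t₀ < t₁) (h₁₂ : t₁ < t₂) (hB : 0 ≤ B)
    (H2 : ∀ t ∈ Icc t₁ t₂, ∀ n : ℕ, 1 ≤ n →
      |deBruijnZero t n - classicalLocation (n : ℝ)| ≤ B * logPlus (classicalLocation (n : ℝ)))
    (H1 : ∀ t ∈ Icc t₁ t₂, ∀ j k : ℤ, j ≠ 0 → k ≠ 0 → k ≠ j →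
      hamiltonianInteraction t j k ≤ A * (logPlus j ^ 2 * logPlus (logPlus j)))
    {a b : ℤ} {L m N : ℕ} (hL : 1 ≤ L) (ha : 2 ≤ a - m * L) (hab : a < b) (hbN : b + m * L ≤ N)
    (hfar : ∀ t ∈ Icc t₁ t₂, ∀ k : ℤ, 2 ≤ k → k ≤ N → ∀ S : Finset ℤ,
      (∀ j ∈ S, j ≠ 0 ∧ (L : ℤ) ≤ |k - j|) → ∑ j ∈ S, interactionEnergy t j k ≤ C)
    (hgrow : (N : ℝ) ^ 2 * (4 * π + 2 * B * logPlus (classicalLocation N)) ^ 2 *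
        Real.exp (2 * (max A 0 * (logPlus N ^ 2 * logPlus (logPlus N)))) < (1 + 1 / (4 * L)) ^ m) :
    3 * ∫ t in t₁..t₂, ∑ p ∈ (zstarIcc a b).offDiag, interactionEnergy t p.1 p.2 ≤
      (N : ℝ) ^ 2 * (max A 0 * (logPlus N ^ 2 * logPlus (logPlus N)) +
          Real.log (2 * (classicalLocation N + B * logPlus (classicalLocation N)))) +
        4 * (N : ℝ) ^ 2 * C * (t₂ - t₁) := by
  have h₁₂' : t₁ ≤ t₂ := h₁₂.le
  have hΛs : ∀ t ∈ Icc t₁ t₂, ∃ t₁' : ℝ, t₁' < t ∧ HasOnlyRealZeros (deBruijnH t₁') :=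
    fun t ht ↦ ⟨t₀, lt_of_lt_of_le ht₀ ht.1, hreal⟩
  have H2' : ∀ t ∈ Icc t₁ t₂, ∀ j : ℕ, 1 ≤ j → j ≤ N →
      |deBruijnZero t j - classicalLocation (j : ℝ)| ≤ B * logPlus (classicalLocation (j : ℝ)) :=
    fun t ht j hj _ ↦ H2 t ht j hj
  -- the chain
  set K : ℕ → Finset ℤ := fun i ↦ zstarIcc (a - i * L) (b + i * L) with hK
  set q : ℕ → ℝ := fun i ↦ ∫ t in t₁..t₂, ∑ p ∈ (K i).offDiag, interactionEnergy t p.1 p.2 with hq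
  have hmL : ∀ i : ℕ, i ≤ m → (i : ℤ) * L ≤ m * L := fun i hi ↦ by
    have : (i : ℤ) ≤ m := by exact_mod_cast hi
    have hL' : (0 : ℤ) ≤ L := by positivity
    nlinarith
  have hmL0 : (0 : ℤ) ≤ (m : ℤ) * L := by positivity
  have ha0 : 2 ≤ a := by linarith
  have hbN0 : b ≤ N := by linarith
  have hKsub : ∀ i : ℕ, i ≤ m → K i ⊆ zstarIcc 1 N ∧ ((K i).card : ℝ) ≤ N := fun i hi ↦
    zstarIcc_subset_of_le (by linarith [hmL i hi]) (by linarith [hmL i hi])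
  have hKmono : ∀ i : ℕ, K 0 ⊆ K i := fun i j hj ↦ by
    obtain ⟨hj0, hja, hjb⟩ := mem_zstarIcc.1 hj
    have : (0 : ℤ) ≤ (i : ℤ) * L := by positivity
    exact mem_zstarIcc.2 ⟨hj0, by push_cast at hja ⊢; linarith, by push_cast at hjb ⊢; linarith⟩
  have hint : ∀ S : Finset ℤ, IntervalIntegrable
      (fun t ↦ ∑ p ∈ S.offDiag, interactionEnergy t p.1 p.2) volume t₁ t₂ := fun S ↦
    ((continuousOn_sum_offDiag_interactionEnergy hreal ht₀ S).mono (by rw [uIcc_of_le h₁₂'])).intervalIntegrable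
  -- lower bound `q 0 ≥ (t₂ − t₁)/G²`
  set G : ℝ := 4 * π + 2 * B * logPlus (classicalLocation N) with hG
  have hG0 : 0 < G := by
    have := mul_nonneg (mul_nonneg zero_le_two hB) (logPlus_nonneg (classicalLocation (N : ℝ)))
    rw [hG]; positivity
  have hK0 : K 0 = zstarIcc a b := by simp [hK]
  have hlow : (t₂ - t₁) / G ^ 2 ≤ q 0 := by
    have hpt : ∀ t ∈ Icc t₁ t₂, 1 / G ^ 2 ≤ ∑ p ∈ (K 0).offDiag, interactionEnergy t p.1 p.2 := by
      intro t ht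
      obtain ⟨a', ha'⟩ := Int.eq_ofNat_of_zero_le (by linarith : (0 : ℤ) ≤ a)
      obtain ⟨b', hb'⟩ := Int.eq_ofNat_of_zero_le (by linarith : (0 : ℤ) ≤ b)
      have h := sub_div_sq_le_sum_offDiag_interactionEnergy (hΛs t ht) hB (H2' t ht)
        (a := a') (b := b') (N := N) (K := K 0) (by omega) (by omega) (by omega)
        (by rw [hK0, ha', hb'])
      refine le_trans ?_ h
      rw [← hG]
      exact div_le_div_of_nonneg_right (by
        have : (a' : ℝ) + 1 ≤ b' := by exact_mod_cast (by omega : a' + 1 ≤ b')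
        linarith) (by positivity)
    have hmono := intervalIntegral.integral_mono_on h₁₂' intervalIntegrable_const (hint (K 0)) hpt
    rw [intervalIntegral.integral_const, smul_eq_mul] at hmono
    rw [hq]
    simp only
    rw [div_eq_mul_one_div]
    exact hmono
  have hq0 : 0 < q 0 := lt_of_lt_of_le (div_pos (by linarith) (by positivity)) hlow
  -- upper bound `q m ≤ (t₂ − t₁) N² e^{2A⁺ℓ}`
  set U : ℝ := Real.exp (2 * (max A 0 * (logPlus N ^ 2 * logPlus (logPlus N)))) with hU
  have hup : q m ≤ (t₂ - t₁) * ((N : ℝ) ^ 2 * U) := by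
    have hpt : ∀ t ∈ Icc t₁ t₂, ∑ p ∈ (K m).offDiag, interactionEnergy t p.1 p.2 ≤ (N : ℝ) ^ 2 * U := by
      intro t ht
      have h := sum_offDiag_interactionEnergy_le_of_gapBound (hΛs t ht) (hKsub m le_rfl).1 (H1 t ht)
      refine h.trans ?_
      rw [← hU]
      have hU0 : 0 ≤ U := (Real.exp_pos _).le
      exact mul_le_mul_of_nonneg_right
        (mul_sub_one_le_sq_aux (Nat.cast_nonneg (K m).card) (hKsub m le_rfl).2).1 hU0
    have hmono := intervalIntegral.integral_mono_on h₁₂' (hint (K m)) intervalIntegrable_const hpt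
    rw [intervalIntegral.integral_const, smul_eq_mul] at hmono
    exact hmono
  -- the ratio and the pigeonhole
  set R : ℝ := (N : ℝ) ^ 2 * G ^ 2 * U with hR
  have hqR : q m ≤ R * q 0 := by
    have h1 : (t₂ - t₁) ≤ G ^ 2 * q 0 := by
      have := mul_le_mul_of_nonneg_left hlow (by positivity : (0 : ℝ) ≤ G ^ 2)
      rwa [mul_div_cancel₀ _ (by positivity : G ^ 2 ≠ 0)] at this
    have hNU : (0 : ℝ) ≤ (N : ℝ) ^ 2 * U := by positivity
    calc q m ≤ (t₂ - t₁) * ((N : ℝ) ^ 2 * U) := hup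
      _ ≤ G ^ 2 * q 0 * ((N : ℝ) ^ 2 * U) := mul_le_mul_of_nonneg_right h1 hNU
      _ = R * q 0 := by rw [hR]; ring
  have hL0 : (0 : ℝ) < L := by exact_mod_cast hL
  obtain ⟨i, him, hstep⟩ := exists_succ_le_one_add_mul_of_lt_pow hq0 hqR (by positivity) hgrow
  -- the step `i → i + 1`
  have hi : i ≤ m := him.le
  have e1 : a - (((i + 1 : ℕ) : ℤ)) * L = a - i * L - L := by push_cast; ring
  have e2 : b + (((i + 1 : ℕ) : ℤ)) * L = b + i * L + L := by push_cast; ring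
  have hstep' : ∫ t in t₁..t₂, ∑ p ∈ (zstarIcc (a - i * L - L) (b + i * L + L)).offDiag,
      interactionEnergy t p.1 p.2 ≤ (1 + 1 / (4 * L)) * q i := by
    have := hstep
    simp only [hq, hK, e1, e2] at this
    exact this
  have hfar_i : ∀ t ∈ Icc t₁ t₂, ∀ k ∈ zstarIcc (a - i * L) (b + i * L), ∀ S : Finset ℤ,
      (∀ j ∈ S, j ≠ 0 ∧ (L : ℤ) ≤ |k - j|) → ∑ j ∈ S, interactionEnergy t j k ≤ C := by
    intro t ht k hk S hS
    obtain ⟨-, hka, hkb⟩ := mem_zstarIcc.1 hk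
    exact hfar t ht k (by linarith [hmL i hi]) (by linarith [hmL i hi]) S hS
  have hone := three_mul_integral_le_of_step hreal ht₀ h₁₂' hL hfar_i hstep'
  -- Hamiltonian terms
  have hHam1 := sum_offDiag_hamiltonianInteraction_le_of_gapBound (hKsub i hi).1 (H1 t₁ ⟨le_rfl, h₁₂'⟩)
  have hHam2 := neg_sum_offDiag_hamiltonianInteraction_le_of_location hB (hKsub i hi).1
    (H2' t₂ ⟨h₁₂', le_rfl⟩)
  obtain ⟨hcN, hc2⟩ := mul_sub_one_le_sq_aux (Nat.cast_nonneg (K i).card) (hKsub i hi).2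
  have hℓ : 0 ≤ max A 0 * (logPlus N ^ 2 * logPlus (logPlus N)) :=
    mul_nonneg (le_max_right _ _) (mul_nonneg (sq_nonneg _) (logPlus_nonneg _))
  have hD : 0 ≤ Real.log (2 * (classicalLocation N + B * logPlus (classicalLocation N))) := by
    have hξ : 4 * π ≤ classicalLocation (N : ℝ) :=
      four_pi_le_classicalLocation (by linarith [(Nat.cast_nonneg N : (0 : ℝ) ≤ N)])
    have hBl := mul_nonneg hB (logPlus_nonneg (classicalLocation (N : ℝ)))
    exact Real.log_nonneg (by nlinarith [Real.pi_gt_three])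
  have hC : 0 ≤ C := by
    have := hfar t₁ ⟨le_rfl, h₁₂'⟩ 2 le_rfl (by omega) ∅ (by simp)
    simpa using this
  -- monotonicity `q 0 ≤ q i`
  have hmono : q 0 ≤ q i :=
    intervalIntegral_sum_offDiag_mono (hKmono i) h₁₂'
      (fun t _ x _ y _ _ ↦ interactionEnergy_nonneg t x y) (hint (K 0)) (hint (K i))
  have hq0' : q 0 = ∫ t in t₁..t₂, ∑ p ∈ (zstarIcc a b).offDiag, interactionEnergy t p.1 p.2 := by
    rw [hq]; simp only; rw [hK0]
  rw [← hq0']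
  have ht : 0 ≤ t₂ - t₁ := by linarith
  have P1 := mul_le_mul_of_nonneg_right hcN hℓ
  have P2 := mul_le_mul_of_nonneg_right hcN hD
  have P3 := mul_le_mul_of_nonneg_right (mul_le_mul_of_nonneg_right hc2 hC) ht
  have e3 : 4 * ((zstarIcc (a - i * L) (b + i * L)).card : ℝ) ^ 2 * C * (t₂ - t₁) =
      4 * (((K i).card : ℝ) ^ 2 * C * (t₂ - t₁)) := by simp only [hK]; ring
  rw [e3] at hone
  linarith

/-! ### §8 Assembly: the dyadic sum, the choice of parameters, and the weak energy bound -/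

/-- `Σ_{J ≤ j < k ≤ 2J} E_{jk}(t) ≤ Σ_{[J,2J]_{ℤ*}.offDiag} E(t)` (unordered pairs against ordered
pairs, `E ≥ 0`). [cite: RodgersTaoFMP2020, Prop. 15 p. 38] -/
theorem interactionEnergyDyadicSum_le_sum_offDiag (t J : ℝ) :
    interactionEnergyDyadicSum t J ≤
      ∑ p ∈ (zstarIcc ⌈J⌉ ⌊2 * J⌋).offDiag, interactionEnergy t p.1 p.2 := by
  classical
  rw [interactionEnergyDyadicSum_eq]
  set I := zstarIcc ⌈J⌉ ⌊2 * J⌋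
  have h1 : ∑ j ∈ I, ∑ k ∈ I.filter (fun k ↦ j < k), interactionEnergy t j k =
      ∑ p ∈ (I ×ˢ I).filter (fun p ↦ p.1 < p.2), interactionEnergy t p.1 p.2 := by
    rw [Finset.sum_filter, Finset.sum_product]
    refine Finset.sum_congr rfl fun j _ ↦ ?_
    rw [Finset.sum_filter]
  rw [h1]
  apply Finset.sum_le_sum_of_subset_of_nonneg
  · intro p hp
    rw [Finset.mem_filter, Finset.mem_product] at hp
    exact Finset.mem_offDiag.2 ⟨hp.1.1, hp.1.2, hp.2.ne⟩
  · exact fun _ _ _ ↦ interactionEnergy_nonneg _ _ _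

/-- `t ↦ Σ_{J ≤ j < k ≤ 2J} E_{jk}(t)` is continuous on `[t₁, t₂]` above a real-rooted time.
[cite: RodgersTaoFMP2020, Prop. 15 p. 38; Thm. 11 p. 27] -/
theorem continuousOn_interactionEnergyDyadicSum {t₀ t₁ t₂ : ℝ}
    (hreal : HasOnlyRealZeros (deBruijnH t₀)) (ht₀ : t₀ < t₁) (J : ℝ) :
    ContinuousOn (fun t ↦ interactionEnergyDyadicSum t J) (Icc t₁ t₂) := by
  have e : (fun t ↦ interactionEnergyDyadicSum t J) = fun t ↦
      ∑ j ∈ zstarIcc ⌈J⌉ ⌊2 * J⌋, ∑ k ∈ (zstarIcc ⌈J⌉ ⌊2 * J⌋).filter (fun k ↦ j < k),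
        interactionEnergy t j k := by
    funext t; rw [interactionEnergyDyadicSum_eq]
  rw [e]
  refine continuousOn_finsetSum _ fun j _ ↦ continuousOn_finsetSum _ fun k hk ↦ ?_
  rw [Finset.mem_filter] at hk
  intro t ht
  exact (continuousAt_interactionEnergy ⟨t₀, lt_of_lt_of_le ht₀ ht.1, hreal⟩ hk.2.ne).continuousWithinAt

/-- `C log(4J)⁷ < J` for all large `J` (`log⁷ = o(id)`). [folklore] -/
private theorem exists_mul_log_pow_seven_lt (C : ℝ) :
    ∃ J₁ : ℝ, ∀ J : ℝ, J₁ ≤ J → 2 ≤ J → C * Real.log (4 * J) ^ 7 < J := by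
  have h := (Real.isLittleO_pow_log_id_atTop (n := 7)).bound
    (show (0 : ℝ) < 1 / (8 * (|C| + 1)) by positivity)
  obtain ⟨X, hX⟩ := Filter.eventually_atTop.1 h
  refine ⟨X / 4, fun J hJ hJ2 ↦ ?_⟩
  have hb := hX (4 * J) (by linarith)
  have hlog : 0 ≤ Real.log (4 * J) := Real.log_nonneg (by linarith)
  rw [Real.norm_eq_abs, Real.norm_eq_abs, id, abs_of_pos (by linarith : (0 : ℝ) < 4 * J),
    abs_of_nonneg (pow_nonneg hlog 7)] at hb
  have h1 : C * Real.log (4 * J) ^ 7 ≤ (|C| + 1) * Real.log (4 * J) ^ 7 :=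
    mul_le_mul_of_nonneg_right (by linarith [le_abs_self C]) (pow_nonneg hlog 7)
  have h2 : (|C| + 1) * Real.log (4 * J) ^ 7 ≤ (|C| + 1) * (1 / (8 * (|C| + 1)) * (4 * J)) :=
    mul_le_mul_of_nonneg_left hb (by positivity)
  have h3 : (|C| + 1) * (1 / (8 * (|C| + 1)) * (4 * J)) = J / 2 := by field_simp; ring
  linarith

/-- `log 8 > 2`. [folklore] -/
private theorem two_lt_log_eight : (2 : ℝ) < Real.log 8 := by
  have he := Real.exp_one_lt_d9
  have h : Real.exp 2 < 8 := by
    rw [show (2 : ℝ) = 1 + 1 by norm_num, Real.exp_add]; nlinarith [Real.exp_pos 1]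
  calc (2 : ℝ) = Real.log (Real.exp 2) := (Real.log_exp 2).symm
    _ < Real.log 8 := Real.log_lt_log (Real.exp_pos 2) h

/-- Arithmetic helper for `growth_of_large`: the exponent comparison. [folklore] -/
private theorem growth_expo_aux {X b A' : ℝ} (hX1 : 1 ≤ X) (hb : 0 ≤ b) (hA' : 0 ≤ A') :
    2 * X + 2 * (12 + 2 * b * X) + 2 * (A' * (X ^ 2 * (1 + X))) ≤ (26 + 4 * b + 4 * A') * X ^ 3 := by
  have hX0 : 0 ≤ X := by linarith
  have hX2 : 1 ≤ X ^ 2 := one_le_pow₀ hX1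
  have hX3 : X ≤ X ^ 3 := by
    calc X = X * 1 := by ring
      _ ≤ X * X ^ 2 := mul_le_mul_of_nonneg_left hX2 hX0
      _ = X ^ 3 := by ring
  have hX23 : X ^ 2 ≤ X ^ 3 := by
    calc X ^ 2 = X ^ 2 * 1 := by ring
      _ ≤ X ^ 2 * X := mul_le_mul_of_nonneg_left hX1 (sq_nonneg X)
      _ = X ^ 3 := by ring
  have h13 : (1 : ℝ) ≤ X ^ 3 := le_trans hX1 hX3
  have p1 := mul_le_mul_of_nonneg_left hX3 hb
  have p2 := mul_le_mul_of_nonneg_left hX23 hA'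
  have e : (26 + 4 * b + 4 * A') * X ^ 3 = 26 * X ^ 3 + 4 * (b * X ^ 3) + 4 * (A' * X ^ 3) := by ring
  have e2 : 2 * X + 2 * (12 + 2 * b * X) + 2 * (A' * (X ^ 2 * (1 + X))) =
      24 + 2 * X + 4 * (b * X) + 2 * (A' * X ^ 2) + 2 * (A' * X ^ 3) := by ring
  rw [e, e2]
  linarith

/-- Arithmetic helper for `growth_of_large`: the polylog threshold. [folklore] -/
private theorem growth_mid_aux {X Y D c L J : ℝ} (hX1 : 1 ≤ X) (hD : 1 ≤ D) (hc : 0 ≤ c) (hL0 : 0 ≤ L)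
    (hL2 : L ≤ 2 * D * X ^ 2) (hXY : X ^ 7 ≤ Y)
    (hbig : (4 + 4 * D + 64 * D ^ 2 * c) * Y < J) :
    2 + L + 8 * L ^ 2 * (c * X ^ 3) < J / 2 := by
  have h17 : (1 : ℝ) ≤ X ^ 7 := one_le_pow₀ hX1
  have hX27 : X ^ 2 ≤ X ^ 7 := pow_le_pow_right₀ hX1 (by norm_num)
  have hLsq : L ^ 2 ≤ 4 * D ^ 2 * X ^ 4 := by nlinarith
  have e1 : 8 * L ^ 2 * (c * X ^ 3) ≤ 32 * D ^ 2 * c * X ^ 7 := by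
    have := mul_le_mul_of_nonneg_right hLsq (by positivity : 0 ≤ c * X ^ 3)
    nlinarith
  have e2 : L ≤ 2 * D * X ^ 7 := hL2.trans (mul_le_mul_of_nonneg_left hX27 (by positivity))
  have hD0 : 0 ≤ D := by linarith
  nlinarith [mul_le_mul_of_nonneg_left hXY hD0, mul_le_mul_of_nonneg_left hXY (by positivity : 0 ≤ D ^ 2 * c)]

/-- Arithmetic helper for `growth_of_large`: from the threshold to `c X³ < m/(8L)`. [folklore] -/
private theorem growth_key_aux {X c L J m : ℝ} (hL0 : 0 < L) (hmid : 2 + L + 8 * L ^ 2 * (c * X ^ 3) < J / 2)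
    (hm : (J / 2 - 2) / L - 1 ≤ m) : c * X ^ 3 < m / (8 * L) := by
  have hm' : ((J / 2 - 2) / L - 1) / (8 * L) ≤ m / (8 * L) :=
    div_le_div_of_nonneg_right hm (by positivity)
  refine lt_of_lt_of_le ?_ hm'
  rw [lt_div_iff₀ (by positivity), div_sub_one hL0.ne', lt_div_iff₀ hL0]
  have e : c * X ^ 3 * (8 * L) * L = 8 * L ^ 2 * (c * X ^ 3) := by ring
  rw [e]
  linarith

/-- **The growth comparison** (house form of "The ratio between `Q_{[0.5J,3J]}` and `Q_{[J,2J]}` is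
thus less than `(1+J^{−0.1})^{0.5J/J^{0.1}}`", p. 38, with steps of length `L ≍ log² J` and ratio
`1 + 1/(4L)` instead of `J^{0.1}` and `1 + J^{−0.1}`): for `J` beyond an explicit polylog threshold,
`N² G_N² e^{2A'ℓ(N)} < (1 + 1/(4L))^m`. [cite: RodgersTaoFMP2020, Prop. 15 proof p. 38] -/
theorem growth_of_large {B' A' C₀ D J : ℝ} {N L m : ℕ} (hB' : 0 ≤ B') (hA' : 0 ≤ A')
    (hC₀ : 0 < C₀) (hD : 1 ≤ D)
    (hordN : logPlus (classicalLocation N) ≤ C₀ * logPlus N)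
    (hN6 : 6 ≤ N) (hNJ : (N : ℝ) ≤ 3 * J) (hJ : 4 ≤ J)
    (hL1 : 1 ≤ L) (hL : (L : ℝ) ≤ D * logPlus N ^ 2 + 1)
    (hm : (J / 2 - 2) / L - 1 ≤ m)
    (hbig : (4 + 4 * D + 64 * D ^ 2 * (26 + 4 * B' * C₀ + 4 * A')) * Real.log (4 * J) ^ 7 < J) :
    (N : ℝ) ^ 2 * (4 * π + 2 * B' * logPlus (classicalLocation N)) ^ 2 *
        Real.exp (2 * (A' * (logPlus N ^ 2 * logPlus (logPlus N)))) < (1 + 1 / (4 * L)) ^ m := by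
  set X : ℝ := logPlus N with hXdef
  have hN0 : (0 : ℝ) ≤ N := Nat.cast_nonneg N
  have hN6' : (6 : ℝ) ≤ N := by exact_mod_cast hN6
  have hX : X = Real.log (2 + N) := by rw [hXdef, logPlus, abs_of_nonneg hN0]
  have hX2 : 2 < X := by
    rw [hX]
    exact two_lt_log_eight.trans_le (Real.log_le_log (by norm_num) (by linarith))
  have hX1 : 1 ≤ X := by linarith
  have hexpX : Real.exp X = 2 + N := by rw [hX, Real.exp_log (by linarith)]
  have hXJ : X ≤ Real.log (4 * J) := by
    rw [hX]; exact Real.log_le_log (by linarith) (by linarith)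
  -- the pieces of the left-hand side
  set c₆ : ℝ := 26 + 4 * B' * C₀ + 4 * A' with hc₆
  have hBC : 0 ≤ B' * C₀ := mul_nonneg hB' hC₀.le
  have hG : 4 * π + 2 * B' * logPlus (classicalLocation N) ≤ Real.exp (12 + 2 * B' * C₀ * X) := by
    have h1 : 2 * B' * logPlus (classicalLocation N) ≤ 2 * B' * (C₀ * X) :=
      mul_le_mul_of_nonneg_left hordN (by positivity)
    have h2 : 12 + 2 * B' * C₀ * X + 1 ≤ Real.exp (12 + 2 * B' * C₀ * X) := Real.add_one_le_exp _
    nlinarith [Real.pi_lt_d2]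
  have hG0 : 0 < 4 * π + 2 * B' * logPlus (classicalLocation N) := by
    have := mul_nonneg (mul_nonneg zero_le_two hB') (logPlus_nonneg (classicalLocation (N : ℝ)))
    positivity
  have hN2 : (N : ℝ) ^ 2 ≤ Real.exp (2 * X) := by
    rw [show 2 * X = X + X by ring, Real.exp_add, hexpX]; nlinarith
  have hG2 : (4 * π + 2 * B' * logPlus (classicalLocation N)) ^ 2 ≤
      Real.exp (2 * (12 + 2 * B' * C₀ * X)) := by
    rw [show 2 * (12 + 2 * B' * C₀ * X) = (12 + 2 * B' * C₀ * X) + (12 + 2 * B' * C₀ * X) by ring,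
      Real.exp_add, sq]
    exact mul_le_mul hG hG hG0.le (Real.exp_pos _).le
  have hllX : logPlus X ≤ 1 + X := by
    rw [logPlus, abs_of_nonneg (by linarith)]
    linarith [Real.log_le_sub_one_of_pos (by linarith : (0 : ℝ) < 2 + X)]
  have hℓ : A' * (logPlus N ^ 2 * logPlus (logPlus N)) ≤ A' * (X ^ 2 * (1 + X)) := by
    rw [← hXdef]
    exact mul_le_mul_of_nonneg_left (mul_le_mul_of_nonneg_left hllX (sq_nonneg X)) hA'
  have hLHS : (N : ℝ) ^ 2 * (4 * π + 2 * B' * logPlus (classicalLocation N)) ^ 2 *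
      Real.exp (2 * (A' * (logPlus N ^ 2 * logPlus (logPlus N)))) ≤ Real.exp (c₆ * X ^ 3) := by
    have h1 : (N : ℝ) ^ 2 * (4 * π + 2 * B' * logPlus (classicalLocation N)) ^ 2 *
        Real.exp (2 * (A' * (logPlus N ^ 2 * logPlus (logPlus N)))) ≤
        Real.exp (2 * X) * Real.exp (2 * (12 + 2 * B' * C₀ * X)) * Real.exp (2 * (A' * (X ^ 2 * (1 + X)))) := by
      have e3 : Real.exp (2 * (A' * (logPlus N ^ 2 * logPlus (logPlus N)))) ≤
          Real.exp (2 * (A' * (X ^ 2 * (1 + X)))) := Real.exp_le_exp.2 (by linarith)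
      exact mul_le_mul (mul_le_mul hN2 hG2 (sq_nonneg _) (Real.exp_pos _).le) e3
        (Real.exp_pos _).le (mul_nonneg (Real.exp_pos _).le (Real.exp_pos _).le)
    refine h1.trans ?_
    rw [← Real.exp_add, ← Real.exp_add, Real.exp_le_exp]
    have h := growth_expo_aux hX1 hBC hA' (X := X)
    rw [hc₆]
    have e : 2 * (12 + 2 * (B' * C₀) * X) = 2 * (12 + 2 * B' * C₀ * X) := by ring
    rw [e] at h
    have e' : (26 + 4 * (B' * C₀) + 4 * A') * X ^ 3 = (26 + 4 * B' * C₀ + 4 * A') * X ^ 3 := by ring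
    rw [e'] at h
    linarith
  -- the right-hand side
  have hL0 : (0 : ℝ) < L := by exact_mod_cast hL1
  have hu0 : (0 : ℝ) ≤ 1 / (4 * L) := by positivity
  have hu1 : 1 / (4 * (L : ℝ)) ≤ 1 := by
    rw [div_le_one (by positivity)]; linarith [show (1 : ℝ) ≤ L by exact_mod_cast hL1]
  have hRHS : Real.exp ((m : ℝ) / (8 * L)) ≤ (1 + 1 / (4 * L)) ^ m := by
    have := exp_half_mul_le_one_add_pow hu0 hu1 m
    rwa [show (m : ℝ) * (1 / (4 * L)) / 2 = m / (8 * L) by field_simp; ring] at this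
  -- `c₆ X³ < m/(8L)`
  have hDX : 1 ≤ D * X ^ 2 := by nlinarith
  have hL2 : (L : ℝ) ≤ 2 * D * X ^ 2 := by linarith
  have hX7 : X ^ 7 ≤ Real.log (4 * J) ^ 7 := pow_le_pow_left₀ (by linarith) hXJ 7
  have hc₆0 : 0 ≤ c₆ := by rw [hc₆]; positivity
  have hmid : 2 + (L : ℝ) + 8 * L ^ 2 * (c₆ * X ^ 3) < J / 2 :=
    growth_mid_aux hX1 hD hc₆0 hL0.le hL2 hX7 hbig
  have hkey : c₆ * X ^ 3 < (m : ℝ) / (8 * L) := growth_key_aux hL0 hmid hm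
  calc (N : ℝ) ^ 2 * (4 * π + 2 * B' * logPlus (classicalLocation N)) ^ 2 *
        Real.exp (2 * (A' * (logPlus N ^ 2 * logPlus (logPlus N))))
      ≤ Real.exp (c₆ * X ^ 3) := hLHS
    _ < Real.exp ((m : ℝ) / (8 * L)) := Real.exp_lt_exp.2 hkey
    _ ≤ (1 + 1 / (4 * L)) ^ m := hRHS

/-- The right-hand side of `three_mul_integral_le_of_chain` is `≪ J² log₊³ J` for `N ≤ 3J`.
[cite: RodgersTaoFMP2020, Prop. 15 proof p. 39 ("We conclude that `Q_K ≪ J² log^{O(1)} J`")] -/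
theorem chain_rhs_le {B' A' C₀ C J τ : ℝ} {N : ℕ} (hB' : 0 ≤ B') (hA' : 0 ≤ A') (hC₀ : 0 < C₀)
    (hC : 0 ≤ C) (hτ : 0 ≤ τ) (hJ : 2 ≤ J) (hN6 : 6 ≤ N) (hNJ : (N : ℝ) ≤ 3 * J)
    (hξN : classicalLocation N ≤ C₀ * (N / logPlus N))
    (hordN : logPlus (classicalLocation N) ≤ C₀ * logPlus N) :
    (N : ℝ) ^ 2 * (A' * (logPlus N ^ 2 * logPlus (logPlus N)) +
          Real.log (2 * (classicalLocation N + B' * logPlus (classicalLocation N)))) +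
        4 * (N : ℝ) ^ 2 * C * τ ≤
      3 * ((24 * (2 * A' + (|Real.log (2 * C₀ * (1 + B'))| + 1) + 4 * C * τ)) * J ^ 2 * logPlus J ^ 3) := by
  set X : ℝ := logPlus N with hXdef
  have hN0 : (0 : ℝ) ≤ N := Nat.cast_nonneg N
  have hN6' : (6 : ℝ) ≤ N := by exact_mod_cast hN6
  have hX : X = Real.log (2 + N) := by rw [hXdef, logPlus, abs_of_nonneg hN0]
  have hX2 : 2 < X := by
    rw [hX]
    exact two_lt_log_eight.trans_le (Real.log_le_log (by norm_num) (by linarith))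
  have hX1 : 1 ≤ X := by linarith
  have hX0 : 0 ≤ X := by linarith
  have hexpX : Real.exp X = 2 + N := by rw [hX, Real.exp_log (by linarith)]
  have hX3 : X ≤ X ^ 3 := by
    calc X = X * 1 := by ring
      _ ≤ X * X ^ 2 := mul_le_mul_of_nonneg_left (one_le_pow₀ hX1) hX0
      _ = X ^ 3 := by ring
  have h13 : (1 : ℝ) ≤ X ^ 3 := le_trans hX1 hX3
  -- `ℓ(N) ≤ 2X³`
  have hllX : logPlus X ≤ 1 + X := by
    rw [logPlus, abs_of_nonneg hX0]
    linarith [Real.log_le_sub_one_of_pos (by linarith : (0 : ℝ) < 2 + X)]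
  have hℓ : logPlus N ^ 2 * logPlus (logPlus N) ≤ 2 * X ^ 3 := by
    rw [← hXdef]
    calc X ^ 2 * logPlus X ≤ X ^ 2 * (1 + X) := mul_le_mul_of_nonneg_left hllX (sq_nonneg X)
      _ = X ^ 2 + X ^ 3 := by ring
      _ ≤ 2 * X ^ 3 := by nlinarith
  -- `log D_N ≤ c₇ X³`
  set c₇ : ℝ := |Real.log (2 * C₀ * (1 + B'))| + 1 with hc₇
  have hξpos : 0 < classicalLocation (N : ℝ) := classicalLocation_pos (by linarith)
  have hξle : classicalLocation (N : ℝ) ≤ C₀ * N := by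
    refine hξN.trans (mul_le_mul_of_nonneg_left (div_le_self hN0 hX1) hC₀.le)
  have hDN : 2 * (classicalLocation N + B' * logPlus (classicalLocation N)) ≤
      2 * C₀ * (1 + B') * Real.exp X := by
    rw [hexpX]
    have h1 : B' * logPlus (classicalLocation N) ≤ B' * (C₀ * X) := mul_le_mul_of_nonneg_left hordN hB'
    have hXN : X ≤ 2 + N := by
      rw [hX]; linarith [Real.log_le_sub_one_of_pos (by linarith : (0 : ℝ) < 2 + N)]
    have hBC : 0 ≤ B' * C₀ := mul_nonneg hB' hC₀.le
    nlinarith [mul_le_mul_of_nonneg_left hXN hBC, mul_le_mul_of_nonneg_left (by linarith : (N : ℝ) ≤ 2 + N) hC₀.le]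
  have hDpos : 0 < 2 * (classicalLocation N + B' * logPlus (classicalLocation N)) := by
    have := mul_nonneg hB' (logPlus_nonneg (classicalLocation (N : ℝ)))
    positivity
  have hK0 : 0 < 2 * C₀ * (1 + B') := by positivity
  have hlogD : Real.log (2 * (classicalLocation N + B' * logPlus (classicalLocation N))) ≤ c₇ * X ^ 3 := by
    calc Real.log (2 * (classicalLocation N + B' * logPlus (classicalLocation N)))
        ≤ Real.log (2 * C₀ * (1 + B') * Real.exp X) := Real.log_le_log hDpos hDN
      _ = Real.log (2 * C₀ * (1 + B')) + X := by
          rw [Real.log_mul hK0.ne' (Real.exp_pos X).ne', Real.log_exp]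
      _ ≤ |Real.log (2 * C₀ * (1 + B'))| * X ^ 3 + X ^ 3 := by
          have h1 := le_abs_self (Real.log (2 * C₀ * (1 + B')))
          have h2 : |Real.log (2 * C₀ * (1 + B'))| ≤ |Real.log (2 * C₀ * (1 + B'))| * X ^ 3 :=
            le_mul_of_one_le_right (abs_nonneg _) h13
          linarith
      _ = c₇ * X ^ 3 := by rw [hc₇]; ring
  -- `X ≤ 2 log₊ J`
  have hXJ : X ≤ 2 * logPlus J := by
    rw [hX, logPlus, abs_of_nonneg (by linarith), ← Real.log_rpow (by linarith), Real.rpow_two]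
    exact Real.log_le_log (by linarith) (by nlinarith)
  have hX3J : X ^ 3 ≤ 8 * logPlus J ^ 3 := by
    have := pow_le_pow_left₀ hX0 hXJ 3
    nlinarith
  have hN2 : (N : ℝ) ^ 2 ≤ 9 * J ^ 2 := by nlinarith
  have hc₇0 : 0 ≤ c₇ := by rw [hc₇]; positivity
  -- assemble
  have hin : A' * (logPlus N ^ 2 * logPlus (logPlus N)) +
      Real.log (2 * (classicalLocation N + B' * logPlus (classicalLocation N))) ≤ (2 * A' + c₇) * X ^ 3 := by
    have p := mul_le_mul_of_nonneg_left hℓ hA'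
    have e : (2 * A' + c₇) * X ^ 3 = A' * (2 * X ^ 3) + c₇ * X ^ 3 := by ring
    rw [e]
    linarith
  have hin0 : 0 ≤ (2 * A' + c₇) * X ^ 3 := by positivity
  have hCt : 4 * (N : ℝ) ^ 2 * C * τ ≤ 36 * J ^ 2 * (C * τ) * X ^ 3 := by
    have hCτ : 0 ≤ C * τ := mul_nonneg hC hτ
    have p := mul_le_mul_of_nonneg_right hN2 hCτ
    have q : 9 * J ^ 2 * (C * τ) ≤ 9 * J ^ 2 * (C * τ) * X ^ 3 :=
      le_mul_of_one_le_right (by positivity) h13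
    have e : 4 * (N : ℝ) ^ 2 * C * τ = 4 * ((N : ℝ) ^ 2 * (C * τ)) := by ring
    rw [e]
    linarith
  have hJ2 : 0 ≤ J ^ 2 := sq_nonneg J
  calc (N : ℝ) ^ 2 * (A' * (logPlus N ^ 2 * logPlus (logPlus N)) +
          Real.log (2 * (classicalLocation N + B' * logPlus (classicalLocation N)))) + 4 * (N : ℝ) ^ 2 * C * τ
      ≤ 9 * J ^ 2 * ((2 * A' + c₇) * X ^ 3) + 36 * J ^ 2 * (C * τ) * X ^ 3 := by
        have p1 := mul_le_mul_of_nonneg_left hin (sq_nonneg (N : ℝ))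
        have p2 := mul_le_mul_of_nonneg_right hN2 hin0
        linarith
    _ = 9 * J ^ 2 * X ^ 3 * (2 * A' + c₇ + 4 * C * τ) := by ring
    _ ≤ 9 * J ^ 2 * (8 * logPlus J ^ 3) * (2 * A' + c₇ + 4 * C * τ) := by
        have hpos : 0 ≤ 2 * A' + c₇ + 4 * C * τ := by positivity
        have := mul_le_mul_of_nonneg_left hX3J (by positivity : 0 ≤ 9 * J ^ 2)
        exact mul_le_mul_of_nonneg_right this hpos
    _ = 3 * ((24 * (2 * A' + c₇ + 4 * C * τ)) * J ^ 2 * logPlus J ^ 3) := by ring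

/-- **Rodgers–Tao Prop. 15 (weak bound on integrated energy), RH-FREE CONTENT twin, modulo the
per-zero far-field constant.** On a time interval `[t₁, t₂]` above a real-rooted time `t₀ < t₁`,
the location law (50) on `[t₁, t₂]` and a uniform bound `C` for the far-environment energy sums of
single zeros (index distance `≥ L` with `L ≥ D log₊² M`) give `M₀`, `α` with
`∫_{t₁}^{t₂} Σ_{J ≤ j < k ≤ 2J} E_{jk}(t) dt ≤ M₀ J² log₊^α J` for every real `J ≥ 1` (`α = 3`).
The gap bound (Prop. 13) is not a hypothesis: it is the kernel theorem `rodgers_tao_gap_bound_of`.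
[cite: RodgersTaoFMP2020, Prop. 15 = v4 Prop. 6.1, p. 38; proof pp. 38–39] -/
theorem rodgers_tao_weak_energy_bound_of_far {t₀ t₁ t₂ B C D : ℝ}
    (hreal : HasOnlyRealZeros (deBruijnH t₀)) (ht₀ : t₀ < t₁) (h12 : t₁ < t₂)
    (H2 : ∀ t ∈ Icc t₁ t₂, ∀ n : ℕ, 1 ≤ n →
      |deBruijnZero t n - classicalLocation (n : ℝ)| ≤ B * logPlus (classicalLocation (n : ℝ)))
    (hC : 0 ≤ C) (hD : 1 ≤ D)
    (hfarC : ∀ t ∈ Icc t₁ t₂, ∀ (M L : ℕ) (k : ℤ), 2 ≤ k → k ≤ M → D * logPlus (M : ℝ) ^ 2 ≤ L →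
      ∀ S : Finset ℤ, (∀ j ∈ S, j ≠ 0 ∧ (L : ℤ) ≤ |k - j|) →
        ∑ j ∈ S, interactionEnergy t j k ≤ C) :
    ∃ M₀ : ℝ, ∃ α : ℕ, 0 ≤ M₀ ∧ ∀ J : ℝ, 1 ≤ J →
      ∫ t in t₁..t₂, interactionEnergyDyadicSum t J ≤ M₀ * J ^ 2 * logPlus J ^ α := by
  have h12' : t₁ ≤ t₂ := h12.le
  -- constants
  set B' : ℝ := max B 0 with hB'def
  have hB' : 0 ≤ B' := le_max_right _ _
  have H2' : ∀ t ∈ Icc t₁ t₂, ∀ n : ℕ, 1 ≤ n →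
      |deBruijnZero t n - classicalLocation (n : ℝ)| ≤ B' * logPlus (classicalLocation (n : ℝ)) :=
    fun t ht n hn ↦ (H2 t ht n hn).trans
      (mul_le_mul_of_nonneg_right (le_max_left _ _) (logPlus_nonneg _))
  obtain ⟨A, hA⟩ := rodgers_tao_gap_bound_of ht₀ hreal H2
  set A' : ℝ := max A 0 with hA'def
  have hA' : 0 ≤ A' := le_max_right _ _
  obtain ⟨c₀, C₀, hc₀, hcC, hord⟩ := lemma8_i_order
  have hC₀ : 0 < C₀ := lt_of_lt_of_le hc₀ hcC
  set Cstar : ℝ := 4 + 4 * D + 64 * D ^ 2 * (26 + 4 * B' * C₀ + 4 * A') with hCstar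
  obtain ⟨J₁, hJ₁⟩ := exists_mul_log_pow_seven_lt Cstar
  set Jstar : ℝ := max 4 J₁ with hJstar
  set M₁ : ℝ := 24 * (2 * A' + (|Real.log (2 * C₀ * (1 + B'))| + 1) + 4 * C * (t₂ - t₁)) with hM₁
  have hM₁0 : 0 ≤ M₁ := by
    have : 0 ≤ C * (t₂ - t₁) := mul_nonneg hC (by linarith)
    rw [hM₁]; positivity
  set N₁ : ℕ := ⌊2 * Jstar⌋₊ + 1 with hN₁
  have hint : ∀ S : Finset ℤ, IntervalIntegrable
      (fun t ↦ ∑ p ∈ S.offDiag, interactionEnergy t p.1 p.2) volume t₁ t₂ := fun S ↦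
    ((continuousOn_sum_offDiag_interactionEnergy hreal ht₀ S).mono (by rw [uIcc_of_le h12'])).intervalIntegrable
  set Q₁ : ℝ := ∫ t in t₁..t₂, ∑ p ∈ (zstarIcc 1 N₁).offDiag, interactionEnergy t p.1 p.2 with hQ₁
  have hQ₁ : 0 ≤ Q₁ := intervalIntegral.integral_nonneg h12' fun t _ ↦
    Finset.sum_nonneg fun _ _ ↦ interactionEnergy_nonneg _ _ _
  refine ⟨M₁ + Q₁, 3, by linarith, fun J hJ1 ↦ ?_⟩
  -- the dyadic integral against `Q_{[⌈J⌉, ⌊2J⌋]}`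
  have hdy : ∫ t in t₁..t₂, interactionEnergyDyadicSum t J ≤
      ∫ t in t₁..t₂, ∑ p ∈ (zstarIcc ⌈J⌉ ⌊2 * J⌋).offDiag, interactionEnergy t p.1 p.2 :=
    intervalIntegral.integral_mono_on h12'
      (((continuousOn_interactionEnergyDyadicSum hreal ht₀ J).mono
        (by rw [uIcc_of_le h12'])).intervalIntegrable) (hint _)
      fun t _ ↦ interactionEnergyDyadicSum_le_sum_offDiag t J
  have hJJ : 1 ≤ J ^ 2 * logPlus J ^ 3 := by
    have h1 : 1 ≤ J ^ 2 := by nlinarith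
    have h2 : 1 ≤ logPlus J := by
      rw [logPlus, abs_of_nonneg (by linarith)]
      have : Real.exp 1 ≤ 2 + J := by linarith [Real.exp_one_lt_d9]
      calc (1 : ℝ) = Real.log (Real.exp 1) := (Real.log_exp 1).symm
        _ ≤ Real.log (2 + J) := Real.log_le_log (Real.exp_pos 1) this
    nlinarith [one_le_pow₀ (n := 3) h2]
  have hJJ0 : 0 ≤ J ^ 2 * logPlus J ^ 3 := zero_le_one.trans hJJ
  have hceil1 : (1 : ℤ) ≤ ⌈J⌉ := by
    have : (0 : ℤ) < ⌈J⌉ := Int.lt_ceil.2 (by push_cast; linarith)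
    omega
  have hfin : ∀ Q : ℝ, Q ≤ Q₁ ∨ Q ≤ M₁ * J ^ 2 * logPlus J ^ 3 →
      Q ≤ (M₁ + Q₁) * J ^ 2 * logPlus J ^ 3 := by
    intro Q hQ
    have e : (M₁ + Q₁) * J ^ 2 * logPlus J ^ 3 =
        M₁ * (J ^ 2 * logPlus J ^ 3) + Q₁ * (J ^ 2 * logPlus J ^ 3) := by ring
    have p1 : Q₁ * 1 ≤ Q₁ * (J ^ 2 * logPlus J ^ 3) := mul_le_mul_of_nonneg_left hJJ hQ₁
    have p2 : 0 ≤ M₁ * (J ^ 2 * logPlus J ^ 3) := mul_nonneg hM₁0 hJJ0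
    have p3 : 0 ≤ Q₁ * (J ^ 2 * logPlus J ^ 3) := mul_nonneg hQ₁ hJJ0
    have e2 : M₁ * J ^ 2 * logPlus J ^ 3 = M₁ * (J ^ 2 * logPlus J ^ 3) := by ring
    rw [e]
    rcases hQ with hQ | hQ
    · linarith only [hQ, p1, p2]
    · rw [e2] at hQ; linarith only [hQ, p3]
  rcases lt_or_ge J Jstar with hsmall | hlarge
  · -- small `J`: `[⌈J⌉, ⌊2J⌋]_{ℤ*} ⊆ [1, N₁]_{ℤ*}`
    have hb : ⌊2 * J⌋ < (N₁ : ℤ) := by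
      have h1 : (⌊2 * J⌋ : ℝ) ≤ 2 * J := Int.floor_le _
      have h2 : 2 * Jstar < (N₁ : ℝ) := by
        rw [hN₁]; push_cast; linarith only [Nat.lt_floor_add_one (2 * Jstar)]
      have h3 : (⌊2 * J⌋ : ℝ) < (N₁ : ℝ) := by linarith only [h1, h2, hsmall]
      exact_mod_cast h3
    have hsub : zstarIcc ⌈J⌉ ⌊2 * J⌋ ⊆ zstarIcc 1 N₁ := fun j hj ↦ by
      obtain ⟨hj0, hja, hjb⟩ := mem_zstarIcc.1 hj
      exact mem_zstarIcc.2 ⟨hj0, by omega, by omega⟩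
    have hmono : ∫ t in t₁..t₂, ∑ p ∈ (zstarIcc ⌈J⌉ ⌊2 * J⌋).offDiag, interactionEnergy t p.1 p.2 ≤ Q₁ :=
      intervalIntegral_sum_offDiag_mono hsub h12'
        (fun t _ x _ y _ _ ↦ interactionEnergy_nonneg t x y) (hint _) (hint _)
    exact hfin _ (Or.inl (hdy.trans hmono))
  · -- large `J`: the chain
    have hJ4 : 4 ≤ J := le_trans (le_max_left _ _) hlarge
    have hJ2 : 2 ≤ J := by linarith
    have hJ₁J : J₁ ≤ J := le_trans (le_max_right _ _) hlarge
    have hbig : Cstar * Real.log (4 * J) ^ 7 < J := hJ₁ J hJ₁J hJ2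
    set N : ℕ := ⌊3 * J⌋₊ with hNdef
    have hNJ : (N : ℝ) ≤ 3 * J := Nat.floor_le (by linarith)
    have hNJ' : 3 * J < (N : ℝ) + 1 := Nat.lt_floor_add_one _
    have hN6 : 6 ≤ N := Nat.le_floor (by push_cast; linarith)
    have hN1 : (1 : ℝ) ≤ N := by exact_mod_cast (by omega : 1 ≤ N)
    have hXpos : 0 < D * logPlus (N : ℝ) ^ 2 := by
      have : 0 < logPlus (N : ℝ) := logPlus_pos _
      positivity
    set L : ℕ := ⌈D * logPlus (N : ℝ) ^ 2⌉₊ with hLdef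
    have hLge : D * logPlus (N : ℝ) ^ 2 ≤ (L : ℝ) := Nat.le_ceil _
    have hLlt : (L : ℝ) < D * logPlus (N : ℝ) ^ 2 + 1 := Nat.ceil_lt_add_one hXpos.le
    have hL1 : 1 ≤ L := Nat.one_le_iff_ne_zero.2 (Nat.pos_iff_ne_zero.1 (Nat.ceil_pos.2 hXpos))
    have hL0 : (0 : ℝ) < L := by exact_mod_cast hL1
    have hy0 : 0 ≤ (J / 2 - 2) / L := div_nonneg (by linarith) hL0.le
    set m : ℕ := ⌊(J / 2 - 2) / L⌋₊ with hmdef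
    have hmle : (m : ℝ) ≤ (J / 2 - 2) / L := Nat.floor_le hy0
    have hmlt : (J / 2 - 2) / L < (m : ℝ) + 1 := Nat.lt_floor_add_one _
    have hmL : (m : ℝ) * L ≤ J / 2 - 2 := (le_div_iff₀ hL0).1 hmle
    -- the integer side conditions
    have hceil : (J : ℝ) ≤ ⌈J⌉ := Int.le_ceil J
    have hceil' : (⌈J⌉ : ℝ) < J + 1 := Int.ceil_lt_add_one J
    have hfloor : (⌊2 * J⌋ : ℝ) ≤ 2 * J := Int.floor_le _
    have hfloor' : 2 * J < (⌊2 * J⌋ : ℝ) + 1 := Int.lt_floor_add_one _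
    have ha : (2 : ℤ) ≤ ⌈J⌉ - (m : ℤ) * L := by
      have : (2 : ℝ) ≤ (⌈J⌉ : ℝ) - (m : ℝ) * L := by linarith only [hceil, hmL, hJ4]
      exact_mod_cast this
    have hab : ⌈J⌉ < ⌊2 * J⌋ := by
      have : (⌈J⌉ : ℝ) < (⌊2 * J⌋ : ℝ) := by linarith only [hceil', hfloor', hJ4]
      exact_mod_cast this
    have hbN : ⌊2 * J⌋ + (m : ℤ) * L ≤ (N : ℤ) := by
      have : (⌊2 * J⌋ : ℝ) + (m : ℝ) * L ≤ (N : ℝ) := by linarith only [hfloor, hmL, hNJ', hJ4]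
      exact_mod_cast this
    have hfar : ∀ t ∈ Icc t₁ t₂, ∀ k : ℤ, 2 ≤ k → k ≤ N → ∀ S : Finset ℤ,
        (∀ j ∈ S, j ≠ 0 ∧ (L : ℤ) ≤ |k - j|) → ∑ j ∈ S, interactionEnergy t j k ≤ C :=
      fun t ht k hk2 hkN S hS ↦ hfarC t ht N L k hk2 hkN hLge S hS
    have hordN : logPlus (classicalLocation N) ≤ C₀ * logPlus N := (hord N hN1).2.2.2
    have hξN : classicalLocation N ≤ C₀ * (N / logPlus N) := (hord N hN1).2.1
    have hgrow := growth_of_large hB' hA' hC₀ hD hordN hN6 hNJ hJ4 hL1 hLlt.le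
      (by linarith only [hmlt]) hbig
    have hchain := three_mul_integral_le_of_chain hreal ht₀ h12 hB' H2' hA hL1 ha hab hbN hfar hgrow
    have hrhs := chain_rhs_le hB' hA' hC₀ hC (by linarith : 0 ≤ t₂ - t₁) hJ2 hN6 hNJ hξN hordN
      (A' := A')
    rw [← hM₁] at hrhs
    have h3 := hchain.trans hrhs
    exact hfin _ (Or.inr (hdy.trans (by linarith only [h3])))

/-- **Rodgers–Tao 2020, Proposition 15 (= v4 Prop. 6.1, weak bound on integrated energy) —
RH-FREE CONTENT twin.** «Let `J > 0`. Then `∫_{Λ/2}^0 Σ_{J ≤ j < k ≤ 2J} E_{jk}(t) dt ≪ J² log₊^{O(1)} J`.»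
House time-translated form (cell rulings R2 / (46)(c): the printed range `Λ/2 ≤ t ≤ 0` is
VACUOUS-AS-PRINTED since `Λ ≥ 0`): on any time interval `[t₁, t₂]` above a real-rooted time
`t₀ < t₁`, the location law (50) on `[t₁, t₂]` (the only input of the printed proof besides
Prop. 13, which is the kernel theorem `rodgers_tao_gap_bound_of` under the same hypothesis) gives
`M₀ ≥ 0` and `α` (here `α = 3`) with `∫_{t₁}^{t₂} Σ_{J ≤ j < k ≤ 2J} E_{jk}(t) dt ≤ M₀ J² log₊^α J` for
all real `J ≥ 1` (for `0 < J < 1` the sum is empty, `interactionEnergyDyadicSum_eq_zero_of_lt_one`). Divergences from the printed proof (module docstring): enlargement steps of length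
`L ≍ log² J` with ratio `1 + 1/(4L)` instead of `J^{0.1}` and `1 + J^{−0.1}`; the environment term is
split near/far (E13) instead of the termwise `ab ≪ a² + b²`.
[cite: RodgersTaoFMP2020, Prop. 15 = v4 Prop. 6.1, p. 38; proof pp. 38–39] -/
theorem rodgers_tao_weak_energy_bound_of {t₀ t₁ t₂ B : ℝ}
    (hreal : HasOnlyRealZeros (deBruijnH t₀)) (ht₀ : t₀ < t₁) (h12 : t₁ < t₂)
    (H2 : ∀ t ∈ Icc t₁ t₂, ∀ n : ℕ, 1 ≤ n →
      |deBruijnZero t n - classicalLocation (n : ℝ)| ≤ B * logPlus (classicalLocation (n : ℝ))) :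
    ∃ M₀ : ℝ, ∃ α : ℕ, 0 ≤ M₀ ∧ ∀ J : ℝ, 1 ≤ J →
      ∫ t in t₁..t₂, interactionEnergyDyadicSum t J ≤ M₀ * J ^ 2 * logPlus J ^ α := by
  obtain ⟨C, D, hC, hD, hfar⟩ := exists_far_interactionEnergy_sum_le (t₂ := t₂) hreal ht₀ H2
  exact rodgers_tao_weak_energy_bound_of_far hreal ht₀ h12 H2 hC hD hfar

/-- For `J < 1` the truncation `Σ_{J ≤ j < k ≤ 2J} E_{jk}(t)` is an empty sum (no two members of
`ℤ*` lie in `[J, 2J]`). [cite: RodgersTaoFMP2020, Prop. 15 p. 38] -/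
theorem interactionEnergyDyadicSum_eq_zero_of_lt_one {J : ℝ} (hJ : J < 1) (t : ℝ) :
    interactionEnergyDyadicSum t J = 0 := by
  rw [interactionEnergyDyadicSum_eq]
  refine Finset.sum_eq_zero fun j hj ↦ Finset.sum_eq_zero fun k hk ↦ ?_
  exfalso
  rw [Finset.mem_filter] at hk
  obtain ⟨-, hja, -⟩ := mem_zstarIcc.1 hj
  obtain ⟨-, -, hkb⟩ := mem_zstarIcc.1 hk.1
  have hcf : ⌊2 * J⌋ ≤ ⌈J⌉ := by
    rcases lt_or_ge 0 J with hJ0 | hJ0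
    · have h2 : ⌊2 * J⌋ ≤ 1 := Int.floor_le_iff.2 (by push_cast; linarith)
      have h1 : (0 : ℤ) < ⌈J⌉ := Int.lt_ceil.2 (by exact_mod_cast hJ0)
      omega
    · have h2 : (⌊2 * J⌋ : ℝ) ≤ 2 * J := Int.floor_le _
      have h1 : (J : ℝ) ≤ ⌈J⌉ := Int.le_ceil _
      have : (⌊2 * J⌋ : ℝ) ≤ ⌈J⌉ := by linarith
      exact_mod_cast this
  have := hk.2
  omega

/-- **The as-printed Prop. 15 from the as-printed location law** (both VACUOUS-AS-PRINTED, `Λ ≥ 0`;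
the reduction itself is RH-free content): `RodgersTao2020.cor33_location → rodgers_tao_weak_energy_bound`
(the typed fact of `RodgersTaoGapsEnergy.lean`, p422049: witness `t₀ < 0` real-rooted, integral over
`[t₀/2, 0]`, all real `J > 0`, interval-integrability included).
[cite: RodgersTaoFMP2020, Prop. 15 = v4 Prop. 6.1, p. 38; Cor. 10 (50) p. 23] -/
theorem rodgers_tao_weak_energy_bound_of_cor33_location (h : RodgersTao2020.cor33_location) :
    rodgers_tao_weak_energy_bound := by
  intro t₀ ht₀ hreal
  obtain ⟨A50, hA50⟩ := h
  have H2 : ∀ t ∈ Icc (t₀ / 2) 0, ∀ n : ℕ, 1 ≤ n →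
      |deBruijnZero t n - classicalLocation (n : ℝ)| ≤ A50 * logPlus (classicalLocation (n : ℝ)) :=
    fun t ht n hn ↦ hA50 t ⟨t₀, by linarith [ht.1], hreal⟩ ht.2 n hn
  have h01 : t₀ < t₀ / 2 := by linarith
  obtain ⟨M₀, α, hM₀, hM⟩ := rodgers_tao_weak_energy_bound_of hreal h01 (by linarith) H2
  refine ⟨α, M₀, fun J hJ ↦ ⟨?_, ?_⟩⟩
  · exact ((continuousOn_interactionEnergyDyadicSum hreal h01 J).mono
      (by rw [uIcc_of_le (by linarith)])).intervalIntegrable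
  · rcases le_or_gt 1 J with hJ1 | hJ1
    · have := hM J hJ1
      linarith
    · rw [intervalIntegral.integral_congr (g := fun _ ↦ (0 : ℝ))
        (fun t _ ↦ interactionEnergyDyadicSum_eq_zero_of_lt_one hJ1 t), intervalIntegral.integral_zero]
      have : 0 ≤ logPlus J ^ α := pow_nonneg (logPlus_nonneg J) α
      positivity

end Literature.NumberTheory.LFunctions

end
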